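import Literature.NumberTheory.ConnesConsani2021.QuasiInnerArchResidues
import Literature.NumberTheory.ConnesConsani2021.QuasiInnerPrimeResidues
import HarnessLib

/-!
# Connes–Consani 2021 (JNT) §4.3, Theorem 4.4 (ii) — the residue computation of the negative Fourier
# coefficients of `κκ_p = (ρ_∞ρ_p) ∘ ψ` (PROVED)

LINE 1 — LABEL: RH-FREE corpus literature (function theory of the product `ρ_∞ρ_p` of two local-factor
ratios on `∂ℂ₋`: a contour integral of a meromorphic function); bears_on: W-C/W-P (P5 sequel
vocabulary, no leaf role); WHAT THIS IS NOT: any claim about RH — nothing in this file bears on the truth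
of RH.

Source: A. Connes, C. Consani, *Quasi-inner functions and local factors*, J. Number Theory **226**
(2021) 139–167 = arXiv:2008.10974 [bib: `ConnesConsani2021QuasiInner`], proof of Theorem 4.4 (ii)
(arXiv chunks p0011:L102–p0012:L35): «We compute the Fourier coefficients of the function
`κ_{p,∞}(v) := (ρ_∞ρ_p)(½ + (v+1)/(v−1))` … `a^{(p,∞)}_{−k} = Σ_ℛ Res(ρ_∞(z)ρ_p(z)((2z+1)/(2z−3))^{k−1}
(−8)/(2z−3)²)` … we use the same contour as in Section 2 and the same choice `R = (2m+1)π/log p` as in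
the proof of Lemma 3.2, which ensures that … `|ρ_p(z)| ≤ 1` … The poles are of three kinds. We have the
non-zero poles of `ρ_∞`, the non-zero poles of `ρ_p`, and the double pole at `z = 0`. The residues are,
for the simple poles, multiplied by the value of the other factor at the point … The contribution of the
double pole at `z = 0` … The dependence in `k` is of the form `αx^{k−1} + (k−1)βx^{k−1}`, `x = −1/3`.»

## What is proved (theorems only; vocabulary = `QuasiInnerLocalFactors.lean`)

With `F_ℓ(z) = ρ_∞(z)ρ_p(z)(2z+1)^ℓ(2z−3)^{−ℓ−2}` (`= −⅛ ρ_∞ρ_p ψ⁻¹(z)^ℓ(ψ⁻¹)′(z)`):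
* the pole structure of `F_ℓ` (simple poles at `−2n`, `n ≥ 1`, with residue `r_n ρ_p(−2n)K_ℓ(−2n)`;
  at `2πin/log p`, `n ≠ 0`, with residue `ρ_∞(2πin/log p)(1−p⁻¹)(log p)⁻¹K_ℓ`; a double pole at `0`
  whose residue is `(A + Bℓ)x_0^ℓ`, `x_0 = ψ⁻¹(0) = −⅓`, for two constants `A`, `B` depending only on `p`);
* the residue theorem on the rectangles `[½ − 2j, ½] × [−R_m, R_m]`, `R_m = (2m+1)π/log p` (tree
  `Literature.Analysis.Complex.rectBoundaryIntegral_eq_sum_of_simplePoles`; the double pole is split off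
  as `Ψ(0)z⁻² + Ψ′(0)z⁻¹`), `m → ∞`, then `j → ∞`;
* **`exists_hasSum_fourierCoeff_kappaArchPrime`**: there are `A B : ℂ` with, for every `ℓ ≥ 0`,
  `(κκ_p)^(−ℓ−1) = Σ_{n≥1} α(n)ρ_p(−2n)x(n)^ℓ + Σ_{n≠0} ρ_∞(2πin/log p)·8(1−p⁻¹)log p(4πn+3i log p)⁻²x_p(n)^ℓ
  + (A + Bℓ)x_0^ℓ` — the scalar content of the decomposition `(1 − 𝒫)κκ_p𝒫 = ℰ_∞ + ℰ_p + ℰ_0`.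

No definitions, no named facts; nothing here bears on the truth of RH.
-/

noncomputable section

open _root_.MeasureTheory _root_.Complex AddCircle Filter Set
open scoped Real Topology Nat Interval

namespace Literature.NumberTheory.ConnesConsani2021

namespace QuasiInner

/-! ### A. Plumbing: `ρ_p` off its poles, `Γ_ℝ` off its poles, the kernel -/

section Plumbing

/-- RH-FREE. `ρ_p` is complex differentiable off the imaginary axis (its poles are `2πiℤ/log p`).
[cite: ConnesConsani2021QuasiInner, Lemma 3.1 (ii) (arXiv chunk p0008:L11–L17)] -/
private theorem ap_differentiableAt_rhoPrime' {p : ℕ} (hp : 1 < p) {z : ℂ}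
    (hz : ∀ k : ℤ, z ≠ 2 * π * I * k / Real.log p) : DifferentiableAt ℂ (rhoPrime p) z := by
  have hp0 : (p : ℂ) ≠ 0 := Nat.cast_ne_zero.2 (by omega)
  have hD : (1 - (p : ℂ) ^ (-z)) ≠ 0 := by
    intro h
    obtain ⟨k, hk⟩ := (natCast_cpow_neg_eq_one_iff hp z).1 (sub_eq_zero.1 h).symm
    exact hz k hk
  have h1 : DifferentiableAt ℂ (fun w : ℂ => 1 - (p : ℂ) ^ (w - 1)) z :=
    (differentiableAt_const _).sub ((differentiableAt_id.sub (differentiableAt_const _)).const_cpow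
      (Or.inl hp0))
  have h2 : DifferentiableAt ℂ (fun w : ℂ => 1 - (p : ℂ) ^ (-w)) z :=
    (differentiableAt_const _).sub (differentiableAt_id.neg.const_cpow (Or.inl hp0))
  have heq : rhoPrime p = fun w => (1 - (p : ℂ) ^ (w - 1)) / (1 - (p : ℂ) ^ (-w)) := rfl
  rw [heq]
  exact h1.div h2 hD

/-- RH-FREE. `ρ_p` is complex differentiable off the imaginary axis.
[cite: ConnesConsani2021QuasiInner, Lemma 3.1 (ii) (arXiv chunk p0008:L11–L17)] -/
private theorem ap_differentiableAt_rhoPrime {p : ℕ} (hp : 1 < p) {z : ℂ} (hz : z.re ≠ 0) :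
    DifferentiableAt ℂ (rhoPrime p) z := by
  refine ap_differentiableAt_rhoPrime' hp fun k hk => hz ?_
  rw [hk, Complex.div_ofReal_re]
  simp

/-- RH-FREE. `Γ_ℝ(z) ≠ 0` off the real axis. [folklore] -/
private theorem ap_Gammaℝ_ne_zero_of_im_ne {z : ℂ} (hz : z.im ≠ 0) : Gammaℝ z ≠ 0 := by
  intro h
  obtain ⟨n, hn⟩ := Gammaℝ_eq_zero_iff.1 h
  apply hz
  rw [hn]
  simp

/-- RH-FREE. `Γ_ℝ(z) ≠ 0` unless `Re z ∈ −2ℕ`. [folklore] -/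
private theorem ap_Gammaℝ_ne_zero_of_re_ne {z : ℂ} (hz : ∀ n : ℕ, z.re ≠ -(2 * n)) : Gammaℝ z ≠ 0 := by
  intro h
  obtain ⟨n, hn⟩ := Gammaℝ_eq_zero_iff.1 h
  apply hz n
  rw [hn]
  simp

/-- RH-FREE. The two kernels: `ψ⁻¹(z)^ℓ(ψ⁻¹)′(z) = −8(2z+1)^ℓ(2z−3)^{−ℓ−2}`. [folklore] -/
private theorem ap_kernel_eq (z : ℂ) (ℓ : ℕ) :
    cayleyInv z ^ ℓ * ((-8 : ℂ) / (2 * z - 3) ^ 2) = -8 * ((2 * z + 1) ^ ℓ / (2 * z - 3) ^ (ℓ + 2)) := by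
  rw [cayleyInv, div_pow, pow_add, div_mul_div_comm, mul_comm ((2 * z + 1) ^ ℓ) (-8 : ℂ), mul_div_assoc]

/-- RH-FREE. The kernel is differentiable off `z = 3/2`. [folklore] -/
private theorem ap_differentiableAt_kernel {z : ℂ} (hz : z.re < 3 / 2) (ℓ : ℕ) :
    DifferentiableAt ℂ (fun w : ℂ => (2 * w + 1) ^ ℓ / (2 * w - 3) ^ (ℓ + 2)) z := by
  have h3 : (2 * z - 3) ^ (ℓ + 2) ≠ 0 := by
    apply pow_ne_zero
    intro h
    have := congrArg Complex.re h
    simp at this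
    linarith
  refine DifferentiableAt.div ?_ ?_ h3 <;> fun_prop

/-- RH-FREE. The integrand `F_ℓ = ρ_∞ρ_p(2z+1)^ℓ(2z−3)^{−ℓ−2}` is complex differentiable off the poles of
`ρ_∞` and `ρ_p` in `Re z < 3/2`. [folklore] -/
private theorem ap_differentiableAt_F {p : ℕ} (hp : 1 < p) (ℓ : ℕ) {z : ℂ} (hG : Gammaℝ z ≠ 0)
    (hre : z.re ≠ 0) (hz : z.re < 3 / 2) :
    DifferentiableAt ℂ (fun w : ℂ => rhoArch w * rhoPrime p w * ((2 * w + 1) ^ ℓ / (2 * w - 3) ^ (ℓ + 2)))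
      z :=
  ((differentiableAt_rhoArch hG).mul (ap_differentiableAt_rhoPrime hp hre)).mul
    (ap_differentiableAt_kernel hz ℓ)

end Plumbing

/-! ### B. The three kinds of poles of `F_ℓ = ρ_∞ρ_p(2z+1)^ℓ(2z−3)^{−ℓ−2}` -/

section Poles

/-- RH-FREE. **The non-zero poles of `ρ_∞`**: near `−2n` (`n ≥ 1`) one has `F_ℓ = φ/(z + 2n)` with `φ`
holomorphic on `|z + 2n| < 1` and `φ(−2n) = r_n · ρ_p(−2n) K_ℓ(−2n)` («the residues are, for the simple
poles, multiplied by the value of the other factor at the point … `ρ_p(−2n) = (1−p^{−(2n+1)})/(1−p^{2n})`»).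
[cite: ConnesConsani2021QuasiInner, Thm 4.4 proof (arXiv chunk p0012:L5–L7)] -/
theorem exists_archPrime_eq_div_sub_archPole {p : ℕ} (hp : 1 < p) (ℓ : ℕ) {n : ℕ} (hn : 1 ≤ n) :
    ∃ ψ : ℂ → ℂ, DifferentiableOn ℂ ψ (Metric.ball (-(2 * (n : ℂ))) 1) ∧
      ψ (-(2 * (n : ℂ))) =
        ((((-1 : ℝ) ^ n * 2 * (Real.sqrt π * π ^ (2 * n)) / (n ! * Real.Gamma (n + 1 / 2)) : ℝ)) : ℂ) *
          (rhoPrime p (-(2 * (n : ℂ))) *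
            ((2 * (-(2 * (n : ℂ))) + 1) ^ ℓ / (2 * (-(2 * (n : ℂ))) - 3) ^ (ℓ + 2))) ∧
      ∀ z ∈ Metric.ball (-(2 * (n : ℂ))) 1, z ≠ -(2 * (n : ℂ)) →
        rhoArch z * rhoPrime p z * ((2 * z + 1) ^ ℓ / (2 * z - 3) ^ (ℓ + 2)) = ψ z / (z - -(2 * (n : ℂ))) := by
  obtain ⟨Φ, hΦd, hΦv, hΦeq⟩ := exists_rhoArch_eq_div_sub_pole n
  have hn1 : (1 : ℝ) ≤ n := by exact_mod_cast hn
  have hball : ∀ z ∈ Metric.ball (-(2 * (n : ℂ))) 1, z.re < -1 := by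
    intro z hz
    rw [Metric.mem_ball, dist_eq_norm] at hz
    have h1 : |(z - -(2 * (n : ℂ))).re| < 1 := (abs_re_le_norm _).trans_lt hz
    rw [abs_lt] at h1
    simp at h1
    linarith [h1.2]
  refine ⟨fun z => Φ z * (rhoPrime p z * ((2 * z + 1) ^ ℓ / (2 * z - 3) ^ (ℓ + 2))), ?_, ?_, ?_⟩
  · intro z hz
    have hre := hball z hz
    exact (hΦd z hz).mul (((ap_differentiableAt_rhoPrime hp (by linarith)).mul
      (ap_differentiableAt_kernel (by linarith) ℓ)).differentiableWithinAt)
  · simp only [hΦv]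
  · intro z hz hzn
    rw [hΦeq z hz hzn]
    ring

/-- RH-FREE. **The non-zero poles of `ρ_p`**: near `z_n = 2πin/log p` (`n ≠ 0`) one has
`F_ℓ = φ/(z − z_n)` with `φ` holomorphic near `z_n` and `φ(z_n) = ρ_∞(z_n) · (1 − p⁻¹)(log p)⁻¹ K_ℓ(z_n)`
(«One multiplies the residue by `ρ_∞(2πin/log p)`»; the residue of `ρ_p` is Lemma 3.1 (ii), in the
concrete form of `exists_pole_structure_rhoPrime_kernel`).
[cite: ConnesConsani2021QuasiInner, Thm 4.4 proof (arXiv chunk p0012:L7–L9) with Lemma 3.1 (ii) (p0008:L11–L17)] -/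
theorem exists_archPrime_eq_div_sub_primePole {p : ℕ} (hp : 1 < p) (ℓ : ℕ) {n : ℤ} (hn : n ≠ 0) :
    ∃ ψ : ℂ → ℂ, ∃ V ∈ 𝓝 (2 * π * I * n / Real.log p : ℂ), DifferentiableOn ℂ ψ V ∧
      ψ (2 * π * I * n / Real.log p) =
        rhoArch (2 * π * I * n / Real.log p) * ((1 - (p : ℂ)⁻¹) / Real.log p *
          ((2 * (2 * π * I * n / Real.log p) + 1) ^ ℓ / (2 * (2 * π * I * n / Real.log p) - 3) ^ (ℓ + 2))) ∧
      ∀ z ∈ V, z ≠ 2 * π * I * n / Real.log p →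
        rhoArch z * rhoPrime p z * ((2 * z + 1) ^ ℓ / (2 * z - 3) ^ (ℓ + 2)) =
          ψ z / (z - 2 * π * I * n / Real.log p) := by
  have hlogR : 0 < Real.log p := Real.log_pos (by exact_mod_cast hp)
  obtain ⟨ψ₀, V, hV, hd, hval, heq⟩ := exists_pole_structure_rhoPrime_kernel hp ℓ n
  set c : ℂ := 2 * π * I * n / Real.log p with hc
  have hcim : c.im = 2 * π * n / Real.log p := by rw [hc, Complex.div_ofReal_im]; simp
  have hcim0 : c.im ≠ 0 := by
    rw [hcim]
    have hn' : (n : ℝ) ≠ 0 := by exact_mod_cast hn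
    have : 2 * π * (n : ℝ) ≠ 0 := by positivity
    exact div_ne_zero this hlogR.ne'
  have hW : {w : ℂ | w.im ≠ 0} ∈ 𝓝 c :=
    (isOpen_ne_fun Complex.continuous_im continuous_const).mem_nhds hcim0
  refine ⟨fun w => rhoArch w * (-(1 / 8 : ℂ) * ψ₀ w), V ∩ {w : ℂ | w.im ≠ 0}, inter_mem hV hW, ?_, ?_, ?_⟩
  · intro w hw
    exact ((differentiableAt_rhoArch (ap_Gammaℝ_ne_zero_of_im_ne hw.2)).differentiableWithinAt).mul
      (((hd w hw.1).const_mul _).mono inter_subset_left)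
  · simp only [hval, ap_kernel_eq]
    ring
  · intro w hw hwc
    have h := heq w hw.1 hwc
    rw [ap_kernel_eq] at h
    have h' : rhoPrime p w * ((2 * w + 1) ^ ℓ / (2 * w - 3) ^ (ℓ + 2)) =
        -(1 / 8 : ℂ) * (ψ₀ w / (w - c)) := by
      have e : rhoPrime p w * ((2 * w + 1) ^ ℓ / (2 * w - 3) ^ (ℓ + 2)) =
          -(1 / 8 : ℂ) * (rhoPrime p w * (-8 * ((2 * w + 1) ^ ℓ / (2 * w - 3) ^ (ℓ + 2)))) := by ring
      rw [e, h]
    rw [mul_assoc, h']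
    ring

/-- RH-FREE. **The double pole at `z = 0`**: there are `g` holomorphic near `0` (`g = z²ρ_∞ρ_p`, the
product of the two simple polar parts) and a neighbourhood `W` of `0` with
`F_ℓ(z) = g(z)K_ℓ(z)/z²` on `W ∖ {0}` for every `ℓ` («the double pole at `z = 0`»).
[cite: ConnesConsani2021QuasiInner, Thm 4.4 proof (arXiv chunk p0012:L21–L23)] -/
theorem exists_archPrime_eq_div_sq {p : ℕ} (hp : 1 < p) :
    ∃ g : ℂ → ℂ, ∃ W ∈ 𝓝 (0 : ℂ), W ⊆ Metric.ball (0 : ℂ) 1 ∧ DifferentiableOn ℂ g W ∧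
      ∀ ℓ : ℕ, ∀ z ∈ W, z ≠ 0 →
        rhoArch z * rhoPrime p z * ((2 * z + 1) ^ ℓ / (2 * z - 3) ^ (ℓ + 2)) =
          g z * ((2 * z + 1) ^ ℓ / (2 * z - 3) ^ (ℓ + 2)) / z ^ 2 := by
  obtain ⟨Φ, hΦd, -, hΦeq⟩ := exists_rhoArch_eq_div_sub_pole 0
  simp only [Nat.cast_zero, mul_zero, neg_zero, sub_zero] at hΦd hΦeq
  obtain ⟨ψ₀, V, hV, hd, -, heq⟩ := exists_pole_structure_rhoPrime_kernel hp 0 0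
  simp only [Int.cast_zero, mul_zero, zero_div, sub_zero, pow_zero, one_mul] at hV hd heq
  refine ⟨fun z => Φ z * (-(1 / 8 : ℂ) * ψ₀ z * (2 * z - 3) ^ 2), Metric.ball (0 : ℂ) 1 ∩ V,
    inter_mem (Metric.ball_mem_nhds _ one_pos) hV, inter_subset_left, ?_, ?_⟩
  · intro z hz
    have h1 : DifferentiableWithinAt ℂ Φ (Metric.ball (0 : ℂ) 1 ∩ V) z := (hΦd z hz.1).mono inter_subset_left
    have h2 : DifferentiableWithinAt ℂ ψ₀ (Metric.ball (0 : ℂ) 1 ∩ V) z := (hd z hz.2).mono inter_subset_right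
    have h3 : DifferentiableWithinAt ℂ (fun z : ℂ => (2 * z - 3) ^ 2) (Metric.ball (0 : ℂ) 1 ∩ V) z :=
      (((differentiableAt_id.const_mul (2 : ℂ)).sub (differentiableAt_const (3 : ℂ))).pow 2).differentiableWithinAt
    exact h1.mul ((h2.const_mul _).mul h3)
  · intro ℓ z hz hz0
    have hre : z.re < 1 := by
      have h := hz.1
      rw [Metric.mem_ball, dist_zero_right] at h
      exact (abs_re_le_norm z |>.trans_lt h) |> (abs_lt.1 · |>.2)
    have h3 : (2 * z - 3 : ℂ) ≠ 0 := by
      intro h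
      have := congrArg Complex.re h
      simp at this
      linarith
    have hρ : rhoPrime p z = -(1 / 8 : ℂ) * ψ₀ z * (2 * z - 3) ^ 2 / z := by
      have hc : (-8 : ℂ) / (2 * z - 3) ^ 2 ≠ 0 := div_ne_zero (by norm_num) (pow_ne_zero _ h3)
      rw [eq_div_of_mul_eq hc (heq z hz.2 hz0)]
      field_simp
    rw [hΦeq z hz.1 hz0, hρ]
    field_simp

end Poles

/-! ### C. Splitting off the double pole: `F_ℓ − az⁻² − bz⁻¹` is holomorphic at `0`, `b = (A + Bℓ)x_0^ℓ` -/

section DoublePole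

/-- RH-FREE. `ψ⁻¹(0) = −⅓`. [cite: ConnesConsani2021QuasiInner, Thm 4.4 proof (arXiv chunk p0012:L25) «x = −1/3»] -/
theorem cayleyInv_zero : cayleyInv 0 = -1 / 3 := by
  norm_num [cayleyInv]

/-- RH-FREE. The kernel `K_ℓ = ψ⁻¹(z)^ℓ(2z−3)^{−2}` has derivative `ℓx_0^ℓ·(−3u₁)/9 + x_0^ℓ v₁` at `0`,
where `u₁ = (ψ⁻¹)′(0)`, `v₁ = ((2z−3)^{−2})′(0)` — i.e. of the form `(a + bℓ)x_0^ℓ`. [folklore] -/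
private theorem ap_hasDerivAt_kernel_zero (ℓ : ℕ) :
    HasDerivAt (fun w : ℂ => (2 * w + 1) ^ ℓ / (2 * w - 3) ^ (ℓ + 2))
      ((ℓ : ℂ) * (-1 / 3 : ℂ) ^ ℓ * (-3) * deriv cayleyInv 0 * (1 / 9) +
        (-1 / 3 : ℂ) ^ ℓ * deriv (fun w : ℂ => ((2 * w - 3) ^ 2)⁻¹) 0) 0 := by
  have h3 : ∀ w : ℂ, w.re < 3 / 2 → (2 * w - 3 : ℂ) ≠ 0 := by
    intro w hw h
    have := congrArg Complex.re h
    simp at this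
    linarith
  have hu : HasDerivAt cayleyInv (deriv cayleyInv 0) 0 := by
    have : DifferentiableAt ℂ cayleyInv 0 := by
      unfold cayleyInv
      exact DifferentiableAt.div (by fun_prop) (by fun_prop) (h3 0 (by norm_num))
    exact this.hasDerivAt
  have hv : HasDerivAt (fun w : ℂ => ((2 * w - 3) ^ 2)⁻¹) (deriv (fun w : ℂ => ((2 * w - 3) ^ 2)⁻¹) 0) 0 := by
    have : DifferentiableAt ℂ (fun w : ℂ => ((2 * w - 3) ^ 2)⁻¹) 0 :=
      DifferentiableAt.inv (by fun_prop) (pow_ne_zero _ (h3 0 (by norm_num)))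
    exact this.hasDerivAt
  have hpow : HasDerivAt (fun w : ℂ => cayleyInv w ^ ℓ)
      ((ℓ : ℂ) * (-1 / 3 : ℂ) ^ ℓ * (-3) * deriv cayleyInv 0) 0 := by
    have h := hu.fun_pow ℓ
    rw [cayleyInv_zero] at h
    refine h.congr_deriv ?_
    rcases Nat.eq_zero_or_pos ℓ with h0 | hpos
    · subst h0; simp
    · obtain ⟨k, rfl⟩ := Nat.exists_eq_add_of_le hpos
      rw [show 1 + k - 1 = k by omega, pow_add, pow_one]
      ring
  have hK : HasDerivAt (fun w : ℂ => cayleyInv w ^ ℓ * ((2 * w - 3) ^ 2)⁻¹)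
      ((ℓ : ℂ) * (-1 / 3 : ℂ) ^ ℓ * (-3) * deriv cayleyInv 0 * ((2 * (0 : ℂ) - 3) ^ 2)⁻¹ +
        cayleyInv 0 ^ ℓ * deriv (fun w : ℂ => ((2 * w - 3) ^ 2)⁻¹) 0) 0 := hpow.fun_mul hv
  have heq : (fun w : ℂ => (2 * w + 1) ^ ℓ / (2 * w - 3) ^ (ℓ + 2)) =ᶠ[𝓝 0]
      fun w : ℂ => cayleyInv w ^ ℓ * ((2 * w - 3) ^ 2)⁻¹ := by
    have hopen : {w : ℂ | w.re < 3 / 2} ∈ 𝓝 (0 : ℂ) :=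
      (isOpen_lt Complex.continuous_re continuous_const).mem_nhds (by norm_num)
    filter_upwards [hopen] with w hw
    have h3w := h3 w hw
    rw [cayleyInv, div_pow, pow_add]
    field_simp
  refine (hK.congr_of_eventuallyEq heq).congr_deriv ?_
  rw [cayleyInv_zero]
  norm_num

/-- RH-FREE. **The double pole at `0`, split off**: there are constants `A`, `B` (depending only on `p`)
such that for every `ℓ` and some `a_ℓ`, the function `F_ℓ − a_ℓz⁻² − (A + Bℓ)x_0^ℓ z⁻¹` has a removable
singularity at `0` (written as a «simple pole with residue `0`», the shape the residue theorem consumes):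
«The expansion at `z = 0` gives a double pole … and a simple pole with residue … The dependence in `k` is
of the form `αx^{k−1} + (k−1)βx^{k−1}`, where `x = −⅓`» (the printed values of `α`, `β` are not needed).
[cite: ConnesConsani2021QuasiInner, Thm 4.4 proof (arXiv chunk p0012:L21–L29)] -/
theorem exists_archPrime_doublePole_sub {p : ℕ} (hp : 1 < p) :
    ∃ A B : ℂ, ∀ ℓ : ℕ, ∃ a : ℂ, ∃ ψ : ℂ → ℂ, ∃ W ∈ 𝓝 (0 : ℂ), DifferentiableOn ℂ ψ W ∧ ψ 0 = 0 ∧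
      ∀ z ∈ W, z ≠ 0 →
        rhoArch z * rhoPrime p z * ((2 * z + 1) ^ ℓ / (2 * z - 3) ^ (ℓ + 2)) - a / z ^ 2 -
            (A + B * ℓ) * (-1 / 3 : ℂ) ^ ℓ / z = ψ z / (z - 0) := by
  obtain ⟨g, W, hW, hWball, hg, hF⟩ := exists_archPrime_eq_div_sq hp
  set u₁ : ℂ := deriv cayleyInv 0 with hu₁
  set v₁ : ℂ := deriv (fun w : ℂ => ((2 * w - 3) ^ 2)⁻¹) 0 with hv₁
  refine ⟨deriv g 0 * (1 / 9) + g 0 * v₁, g 0 * (-3) * u₁ * (1 / 9), fun ℓ => ?_⟩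
  -- `Ψ = g K_ℓ`, `a = Ψ(0)`, `b = Ψ′(0)`
  set K : ℂ → ℂ := fun w => (2 * w + 1) ^ ℓ / (2 * w - 3) ^ (ℓ + 2) with hK
  set Ψ : ℂ → ℂ := fun w => g w * K w with hΨ
  have hre : ∀ z ∈ W, z.re < 3 / 2 := by
    intro z hz
    have h := hWball hz
    rw [Metric.mem_ball, dist_zero_right] at h
    have := (abs_re_le_norm z).trans_lt h
    linarith [(abs_lt.1 this).2]
  have hΨd : DifferentiableOn ℂ Ψ W := fun z hz =>
    (hg z hz).mul (ap_differentiableAt_kernel (hre z hz) ℓ).differentiableWithinAt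
  have hgd : HasDerivAt g (deriv g 0) 0 := (hg.differentiableAt hW).hasDerivAt
  have hK0 : K 0 = (-1 / 3 : ℂ) ^ ℓ * (1 / 9) := by
    rw [hK]
    dsimp only
    rw [mul_zero, zero_add, one_pow, zero_sub, pow_add, show (-1 / 3 : ℂ) = (-3)⁻¹ by norm_num,
      inv_pow]
    have h3 : (-3 : ℂ) ^ ℓ ≠ 0 := pow_ne_zero _ (by norm_num)
    field_simp
    norm_num
  have hdΨ : HasDerivAt Ψ (deriv g 0 * K 0 + g 0 * ((ℓ : ℂ) * (-1 / 3 : ℂ) ^ ℓ * (-3) *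
      deriv cayleyInv 0 * (1 / 9) + (-1 / 3 : ℂ) ^ ℓ * deriv (fun w : ℂ => ((2 * w - 3) ^ 2)⁻¹) 0)) 0 :=
    hgd.fun_mul (ap_hasDerivAt_kernel_zero ℓ)
  have hΨ' : deriv Ψ 0 = (deriv g 0 * (1 / 9) + g 0 * v₁ + g 0 * (-3) * u₁ * (1 / 9) * ℓ) *
      (-1 / 3 : ℂ) ^ ℓ := by
    rw [hdΨ.deriv, hK0]
    ring
  refine ⟨Ψ 0, fun z => z * dslope (dslope Ψ 0) 0 z, W, hW, ?_, by simp, ?_⟩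
  · have h1 : DifferentiableOn ℂ (dslope Ψ 0) W := (differentiableOn_dslope hW).2 hΨd
    have h2 : DifferentiableOn ℂ (dslope (dslope Ψ 0) 0) W := (differentiableOn_dslope hW).2 h1
    exact (differentiableOn_id.mul h2)
  · intro z hz hz0
    have e1 : z * dslope (dslope Ψ 0) 0 z / (z - 0) = dslope (dslope Ψ 0) 0 z := by
      rw [sub_zero, mul_div_cancel_left₀ _ hz0]
    have e2 : dslope (dslope Ψ 0) 0 z = ((Ψ z - Ψ 0) / z - deriv Ψ 0) / z := by
      rw [dslope_of_ne _ hz0, slope_def_field, dslope_of_ne _ hz0, slope_def_field, dslope_same, sub_zero]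
    have hΨz : Ψ z = g z * ((2 * z + 1) ^ ℓ / (2 * z - 3) ^ (ℓ + 2)) := rfl
    rw [e1, e2, hF ℓ z hz hz0, hΨ', hΨz]
    field_simp

/-- RH-FREE. `∮_{∂K} a z⁻² dz = 0` over a rectangle containing `0` in its interior (fundamental theorem of
calculus on the four sides with the primitive `−a/z`). [folklore] -/
private theorem ap_rectBoundaryIntegral_div_sq (m : ℂ) {a b c d : ℝ} (ha : a < 0) (hb : 0 < b)
    (hc : c < 0) (hd : 0 < d) :
    Literature.Analysis.Complex.rectBoundaryIntegral (fun z : ℂ => m / z ^ 2) a b c d = 0 := by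
  -- the primitive `G = −m/z` and its derivative along horizontal / vertical segments
  have hG : ∀ z : ℂ, z ≠ 0 → HasDerivAt (fun w : ℂ => -m * w⁻¹) (m / z ^ 2) z := by
    intro z hz
    refine ((hasDerivAt_inv hz).const_mul (-m)).congr_deriv ?_
    rw [div_eq_mul_inv]
    ring
  have hhor : ∀ y : ℝ, y ≠ 0 → ∫ x in a..b, m / (((x : ℂ) + y * I) ^ 2) =
      -m * ((b : ℂ) + y * I)⁻¹ - -m * ((a : ℂ) + y * I)⁻¹ := by
    intro y hy
    have hne : ∀ x : ℝ, ((x : ℂ) + y * I) ≠ 0 := by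
      intro x h
      have := congrArg Complex.im h
      simp at this
      exact hy this
    apply intervalIntegral.integral_eq_sub_of_hasDerivAt
    · intro x _
      have hpath : HasDerivAt (fun w : ℂ => w + y * I) 1 (x : ℂ) := (hasDerivAt_id' (x : ℂ)).add_const _
      have h1 := HasDerivAt.comp (x : ℂ) (hG ((x : ℂ) + y * I) (hne x)) hpath
      rw [mul_one] at h1
      exact h1.comp_ofReal
    · exact (continuous_const.div (by fun_prop) fun x => pow_ne_zero _ (hne x)).intervalIntegrable _ _
  have hver : ∀ x : ℝ, x ≠ 0 → I * ∫ y in c..d, m / (((x : ℂ) + y * I) ^ 2) =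
      -m * ((x : ℂ) + d * I)⁻¹ - -m * ((x : ℂ) + c * I)⁻¹ := by
    intro x hx
    have hne : ∀ y : ℝ, ((x : ℂ) + y * I) ≠ 0 := by
      intro y h
      have := congrArg Complex.re h
      simp at this
      exact hx this
    rw [← intervalIntegral.integral_const_mul]
    apply intervalIntegral.integral_eq_sub_of_hasDerivAt
    · intro y _
      have hpath : HasDerivAt (fun w : ℂ => (x : ℂ) + w * I) (1 * I) (y : ℂ) :=
        ((hasDerivAt_id' (y : ℂ)).mul_const I).const_add (x : ℂ)
      have h1 := HasDerivAt.comp (y : ℂ) (hG ((x : ℂ) + y * I) (hne y)) hpath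
      have e : m / ((x : ℂ) + y * I) ^ 2 * (1 * I) = I * (m / ((x : ℂ) + y * I) ^ 2) := by ring
      rw [e] at h1
      exact h1.comp_ofReal
    · exact (continuous_const.mul (continuous_const.div (by fun_prop)
        fun y => pow_ne_zero _ (hne y))).intervalIntegrable _ _
  rw [Literature.Analysis.Complex.rectBoundaryIntegral_def, hhor c hc.ne, hhor d hd.ne', hver b hb.ne',
    hver a ha.ne]
  ring

end DoublePole

/-! ### D. The residue theorem on the rectangles `[½ − 2j, ½] × [−R_m, R_m]`, `R_m = (2m+1)π/log p` -/

section Rectangle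

/-- RH-FREE. **The residue formula on the printed rectangles** for `F_ℓ = ρ_∞ρ_p(2z+1)^ℓ(2z−3)^{−ℓ−2}`:
with `R_m = (2m+1)π/log p` («the same choice `R = (2m+1)π/log p` as in the proof of Lemma 3.2») and the
principal part `az⁻² + bz⁻¹` of `F_ℓ` at the double pole `0` split off (hypothesis `hab`, supplied by
`exists_archPrime_doublePole_sub`), the boundary integral over `[½ − 2j, ½] × [−R_m, R_m]` equals `2πi`
times (the residues at the poles `−2n`, `1 ≤ n < j`) + (the residues at `2πin/log p`, `0 < |n| ≤ m`) + `b`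
(«The poles are of three kinds … The residues are, for the simple poles, multiplied by the value of the
other factor at the point»; residue theorem = the tree's
`Literature.Analysis.Complex.rectBoundaryIntegral_eq_sum_of_simplePoles`, `∮az⁻² = 0`, `∮bz⁻¹ = 2πib`).
[cite: ConnesConsani2021QuasiInner, Thm 4.4 proof (arXiv chunks p0011:L104–p0012:L9)] -/
theorem rectBoundaryIntegral_archPrime {p : ℕ} (hp : p.Prime) (ℓ : ℕ) {a b : ℂ}
    (hab : ∃ ψ : ℂ → ℂ, ∃ W ∈ 𝓝 (0 : ℂ), DifferentiableOn ℂ ψ W ∧ ψ 0 = 0 ∧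
      ∀ z ∈ W, z ≠ 0 →
        rhoArch z * rhoPrime p z * ((2 * z + 1) ^ ℓ / (2 * z - 3) ^ (ℓ + 2)) - a / z ^ 2 - b / z =
          ψ z / (z - 0))
    {j m : ℕ} (hj : 1 ≤ j) (hm : 1 ≤ m) :
    Literature.Analysis.Complex.rectBoundaryIntegral
        (fun z : ℂ => rhoArch z * rhoPrime p z * ((2 * z + 1) ^ ℓ / (2 * z - 3) ^ (ℓ + 2)))
        (1 / 2 - 2 * j) (1 / 2) (-((2 * m + 1) * π / Real.log p)) ((2 * m + 1) * π / Real.log p) =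
      2 * π * I *
        ((∑ n ∈ Finset.Ico 1 j,
            ((((-1 : ℝ) ^ n * 2 * (Real.sqrt π * π ^ (2 * n)) / (n ! * Real.Gamma (n + 1 / 2)) : ℝ)) : ℂ) *
              (rhoPrime p (-(2 * (n : ℂ))) *
                ((2 * (-(2 * (n : ℂ))) + 1) ^ ℓ / (2 * (-(2 * (n : ℂ))) - 3) ^ (ℓ + 2)))) +
          (∑ n ∈ (Finset.Icc (-(m : ℤ)) m).erase 0,
            rhoArch (2 * π * I * n / Real.log p) * ((1 - (p : ℂ)⁻¹) / Real.log p *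
              ((2 * (2 * π * I * n / Real.log p) + 1) ^ ℓ /
                (2 * (2 * π * I * n / Real.log p) - 3) ^ (ℓ + 2)))) + b) := by
  classical
  have hp1 : 1 < p := hp.one_lt
  have hlogR : 0 < Real.log p := Real.log_pos (by exact_mod_cast hp1)
  have hj1 : (1 : ℝ) ≤ j := by exact_mod_cast hj
  have hm1 : (1 : ℝ) ≤ m := by exact_mod_cast hm
  set L : ℝ := Real.log p with hL
  set R : ℝ := (2 * m + 1) * π / L with hR
  set R' : ℝ := 2 * π * (m + 1) / L with hR'
  have hR0 : 0 < R := by positivity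
  have hRR' : R < R' := by
    rw [hR, hR', div_lt_div_iff_of_pos_right hlogR]; nlinarith [Real.pi_pos]
  set aj : ℝ := 1 / 2 - 2 * j with haj
  have haj0 : aj < 0 := by rw [haj]; linarith
  have hab' : aj < 1 / 2 := by linarith
  have hcd : -R < R := by linarith
  -- the integrand, the principal part at `0`, the corrected integrand
  set K : ℂ → ℂ := fun z => (2 * z + 1) ^ ℓ / (2 * z - 3) ^ (ℓ + 2) with hK
  set F : ℂ → ℂ := fun z => rhoArch z * rhoPrime p z * K z with hF
  set Q : ℂ → ℂ := fun z => a / z ^ 2 + b / z with hQ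
  set G : ℂ → ℂ := fun z => F z - a / z ^ 2 - b / z with hG
  -- the poles
  set zP : ℤ → ℂ := fun n => 2 * π * I * n / L with hzP
  have hzP_im : ∀ n : ℤ, (zP n).im = 2 * π * n / L := fun n => by
    rw [hzP]; dsimp only; rw [Complex.div_ofReal_im]; simp
  have hzP_re : ∀ n : ℤ, (zP n).re = 0 := fun n => by
    rw [hzP]; dsimp only; rw [Complex.div_ofReal_re]; simp
  have hzP_inj : Function.Injective zP := by
    intro u v h
    have := congrArg Complex.im h
    rw [hzP_im, hzP_im, div_left_inj' hlogR.ne'] at this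
    have h2 : (u : ℝ) = v := by nlinarith [Real.pi_pos]
    exact_mod_cast h2
  have hzP_im_ne : ∀ n : ℤ, n ≠ 0 → (zP n).im ≠ 0 := by
    intro n hn
    rw [hzP_im]
    have : (n : ℝ) ≠ 0 := by exact_mod_cast hn
    exact div_ne_zero (mul_ne_zero (mul_ne_zero two_ne_zero Real.pi_ne_zero) this) hlogR.ne'
  have hzP_ne : ∀ n : ℤ, n ≠ 0 → zP n ≠ 0 := by
    intro n hn h
    exact hzP_im_ne n hn (by rw [h]; simp)
  set zA : ℕ → ℂ := fun n => -(2 * (n : ℂ)) with hzA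
  have hzA_re : ∀ n : ℕ, (zA n).re = -(2 * n) := fun n => by rw [hzA]; simp
  have hzA_im : ∀ n : ℕ, (zA n).im = 0 := fun n => by rw [hzA]; simp
  have hzA_inj : Function.Injective zA := by
    intro u v h
    have := congrArg Complex.re h
    rw [hzA_re, hzA_re] at this
    exact_mod_cast (by linarith : (u : ℝ) = v)
  set SA : Finset ℂ := (Finset.Ico 1 j).image zA with hSA
  set SP : Finset ℂ := ((Finset.Icc (-(m : ℤ)) m).erase 0).image zP with hSP
  set S : Finset ℂ := SA ∪ SP ∪ {0} with hS
  -- the residues, as a function of the pole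
  set r : ℂ → ℂ := fun q => if q = 0 then 0 else if q.im = 0 then
      ((((-1 : ℝ) ^ ⌊-q.re / 2⌋₊ * 2 * (Real.sqrt π * π ^ (2 * ⌊-q.re / 2⌋₊)) /
        (⌊-q.re / 2⌋₊ ! * Real.Gamma (⌊-q.re / 2⌋₊ + 1 / 2)) : ℝ)) : ℂ) * (rhoPrime p q * K q)
      else rhoArch q * ((1 - (p : ℂ)⁻¹) / L * K q) with hr
  have hrA : ∀ n : ℕ, 1 ≤ n → r (zA n) =
      ((((-1 : ℝ) ^ n * 2 * (Real.sqrt π * π ^ (2 * n)) / (n ! * Real.Gamma (n + 1 / 2)) : ℝ)) : ℂ) *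
        (rhoPrime p (zA n) * K (zA n)) := by
    intro n hn
    have hne : zA n ≠ 0 := by
      intro h
      have := congrArg Complex.re h
      rw [hzA_re] at this
      simp at this
      omega
    rw [hr]
    dsimp only
    rw [if_neg hne, if_pos (hzA_im n), hzA_re, neg_neg,
      show (2 * (n : ℝ)) / 2 = n by ring, Nat.floor_natCast]
  have hrP : ∀ n : ℤ, n ≠ 0 → r (zP n) = rhoArch (zP n) * ((1 - (p : ℂ)⁻¹) / L * K (zP n)) := by
    intro n hn
    rw [hr]
    dsimp only
    rw [if_neg (hzP_ne n hn), if_neg (hzP_im_ne n hn)]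
  have hr0 : r 0 = 0 := by rw [hr]; simp
  -- the open set `U` and the rectangle
  set U : Set ℂ := Ioo (1 / 4 - 2 * (j : ℝ)) 1 ×ℂ Ioo (-R') R' with hU
  have hUo : IsOpen U := isOpen_Ioo.reProdIm isOpen_Ioo
  have hKU : Icc aj (1 / 2) ×ℂ Icc (-R) R ⊆ U := by
    intro z hz
    rw [mem_reProdIm] at hz ⊢
    exact ⟨⟨by rw [haj] at hz; linarith [hz.1.1], by linarith [hz.1.2]⟩,
      ⟨by linarith [hz.2.1], by linarith [hz.2.2]⟩⟩
  -- the poles are inside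
  have hSA_sub : (SA : Set ℂ) ⊆ Ioo aj (1 / 2) ×ℂ Ioo (-R) R := by
    intro z hz
    rw [hSA, Finset.coe_image] at hz
    obtain ⟨n, hn, rfl⟩ := hz
    rw [Finset.coe_Ico, mem_Ico] at hn
    have hn1 : (1 : ℝ) ≤ n := by exact_mod_cast hn.1
    have hn2 : (n : ℝ) + 1 ≤ j := by exact_mod_cast hn.2
    rw [mem_reProdIm, hzA_re, hzA_im, haj]
    exact ⟨⟨by linarith, by linarith⟩, ⟨by linarith, by linarith⟩⟩
  have hSP_sub : (SP : Set ℂ) ⊆ Ioo aj (1 / 2) ×ℂ Ioo (-R) R := by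
    intro z hz
    rw [hSP, Finset.coe_image] at hz
    obtain ⟨n, hn, rfl⟩ := hz
    have hn1 := Finset.mem_Icc.1 (Finset.mem_erase.1 (Finset.mem_coe.1 hn)).2
    have hn' : |(n : ℝ)| ≤ m := by
      rw [← Int.cast_abs]; exact_mod_cast abs_le.2 hn1
    rw [mem_reProdIm, hzP_re, hzP_im]
    refine ⟨⟨haj0, by norm_num⟩, ?_⟩
    rw [mem_Ioo, hR, neg_lt, lt_div_iff₀ hlogR, ← neg_div, div_mul_cancel₀ _ hlogR.ne',
      div_lt_div_iff_of_pos_right hlogR]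
    constructor <;> nlinarith [abs_le.1 hn', Real.pi_pos]
  have hSsub : (S : Set ℂ) ⊆ Ioo aj (1 / 2) ×ℂ Ioo (-R) R := by
    intro z hz
    rw [hS, Finset.coe_union, Finset.coe_union, Finset.coe_singleton] at hz
    rcases hz with (hz | hz) | hz
    · exact hSA_sub hz
    · exact hSP_sub hz
    · rw [mem_singleton_iff] at hz
      rw [hz, mem_reProdIm]
      simp only [zero_re, zero_im, mem_Ioo]
      exact ⟨⟨haj0, by norm_num⟩, ⟨by linarith, hR0⟩⟩
  -- `F` is differentiable at the points of `U` that are not poles; so is `G`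
  have hFdiff : ∀ z ∈ U, z ∉ (S : Set ℂ) → DifferentiableAt ℂ F z := by
    intro z hzU hzS
    rw [hU, mem_reProdIm] at hzU
    have hz0 : z ≠ 0 := by
      intro h; apply hzS; rw [h, hS]; simp
    have hGam : Gammaℝ z ≠ 0 := by
      intro h
      obtain ⟨n, hn⟩ := Gammaℝ_eq_zero_iff.1 h
      rcases Nat.eq_zero_or_pos n with hn0 | hnpos
      · apply hz0; rw [hn, hn0]; simp
      · by_cases hnj : n < j
        · apply hzS
          rw [hS, Finset.coe_union, Finset.coe_union]
          left; left
          rw [hSA, Finset.coe_image]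
          exact ⟨n, by rw [Finset.coe_Ico, mem_Ico]; exact ⟨hnpos, hnj⟩, by rw [hn, hzA]⟩
        · have : (j : ℝ) ≤ n := by exact_mod_cast not_lt.1 hnj
          have hre : z.re = -(2 * n) := by rw [hn]; simp
          linarith [hzU.1.1]
    have hlat : ∀ k : ℤ, z ≠ 2 * π * I * k / Real.log p := by
      intro k hk
      have him : |2 * π * k / L| < R' := by
        have := hzU.2
        rw [hk, show (2 * π * I * k / Real.log p : ℂ).im = 2 * π * k / L from hzP_im k] at this
        exact abs_lt.2 this
      have hk' : |(k : ℝ)| < m + 1 := by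
        rw [abs_div, abs_of_pos hlogR, hR', div_lt_div_iff_of_pos_right hlogR, abs_mul,
          abs_of_pos (by positivity : (0:ℝ) < 2 * π)] at him
        nlinarith [Real.pi_pos, abs_nonneg (k : ℝ)]
      have hkm : |k| ≤ (m : ℤ) := by
        have : |(k : ℝ)| < (m : ℤ) + 1 := by push_cast; exact hk'
        rw [← Int.cast_abs] at this
        exact Int.lt_add_one_iff.1 (by exact_mod_cast this)
      rcases eq_or_ne k 0 with hk0 | hk0
      · apply hz0; rw [hk, hk0]; simp
      · apply hzS
        rw [hS, Finset.coe_union, Finset.coe_union]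
        left; right
        rw [hSP, Finset.coe_image]
        refine ⟨k, ?_, hk.symm⟩
        rw [Finset.coe_erase, Finset.coe_Icc]
        exact ⟨abs_le.1 hkm, hk0⟩
    exact ((differentiableAt_rhoArch hGam).mul (ap_differentiableAt_rhoPrime' hp1 hlat)).mul
      (ap_differentiableAt_kernel (by linarith [hzU.1.2]) ℓ)
  have hQa : ∀ z : ℂ, z ≠ 0 → DifferentiableAt ℂ (fun w : ℂ => a / w ^ 2) z := by
    intro z hz
    exact DifferentiableAt.div (c := fun _ : ℂ => a) (d := fun w : ℂ => w ^ 2) (differentiableAt_const _)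
      (differentiableAt_pow 2) (pow_ne_zero _ hz)
  have hQb : ∀ z : ℂ, z ≠ 0 → DifferentiableAt ℂ (fun w : ℂ => b / w) z := by
    intro z hz
    exact DifferentiableAt.div (c := fun _ : ℂ => b) (d := fun w : ℂ => w) (differentiableAt_const _)
      differentiableAt_id hz
  have hQdiff : ∀ z : ℂ, z ≠ 0 → DifferentiableAt ℂ Q z := by
    intro z hz
    rw [hQ]
    exact (hQa z hz).add (hQb z hz)
  have hGQ : ∀ z : ℂ, G z = F z - Q z := by intro z; rw [hG, hQ]; dsimp only; ring
  have hG_of : ∀ z : ℂ, z ≠ 0 → DifferentiableAt ℂ F z → DifferentiableAt ℂ G z := by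
    intro z hz hFz
    have : G = fun w => F w - Q w := funext hGQ
    rw [this]
    exact hFz.sub (hQdiff z hz)
  have hGdiff : DifferentiableOn ℂ G (U \ ↑S) := by
    intro z hz
    have hz0 : z ≠ 0 := by
      intro h; apply hz.2; rw [h, hS]; simp
    exact (hG_of z hz0 (hFdiff z hz.1 hz.2)).differentiableWithinAt
  -- the pole structure of `G`
  have hpole : ∀ q ∈ S, ∃ φ_ : ℂ → ℂ, ∃ V ∈ 𝓝 q, DifferentiableOn ℂ φ_ V ∧ φ_ q = r q ∧
      ∀ z ∈ V, z ≠ q → G z = φ_ z / (z - q) := by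
    intro q hq
    rw [hS, Finset.mem_union, Finset.mem_union] at hq
    rcases hq with (hq | hq) | hq
    · -- a pole `−2n` of `ρ_∞`
      rw [hSA, Finset.mem_image] at hq
      obtain ⟨n, hn, rfl⟩ := hq
      rw [Finset.mem_Ico] at hn
      obtain ⟨ψ, hψd, hψv, hψeq⟩ := exists_archPrime_eq_div_sub_archPole hp1 ℓ hn.1
      have e : (-(2 * (n : ℂ))) = zA n := rfl
      rw [e] at hψd hψv hψeq
      have hball0 : ∀ z ∈ Metric.ball (zA n) 1, z ≠ 0 := by
        intro z hz h
        rw [h, Metric.mem_ball, dist_eq_norm, zero_sub, norm_neg] at hz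
        have h1 : |(zA n).re| ≤ ‖zA n‖ := abs_re_le_norm _
        rw [hzA_re, abs_neg, abs_of_nonneg (by positivity)] at h1
        have : (1 : ℝ) ≤ n := by exact_mod_cast hn.1
        linarith
      refine ⟨fun z => ψ z - Q z * (z - zA n), Metric.ball (zA n) 1, Metric.ball_mem_nhds _ one_pos,
        ?_, ?_, ?_⟩
      · intro z hz
        exact (hψd z hz).sub (((hQdiff z (hball0 z hz)).mul
          (differentiableAt_id.sub (differentiableAt_const _))).differentiableWithinAt)
      · simp only [sub_self, mul_zero, sub_zero]
        rw [hrA n hn.1, hψv]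
      · intro z hz hzq
        have hzq' : z - zA n ≠ 0 := sub_ne_zero.2 hzq
        rw [hGQ, hF]
        dsimp only
        rw [hψeq z hz hzq]
        field_simp
    · -- a pole `2πin/log p` of `ρ_p`
      rw [hSP, Finset.mem_image] at hq
      obtain ⟨n, hn, rfl⟩ := hq
      rw [Finset.mem_erase] at hn
      obtain ⟨ψ, V, hV, hψd, hψv, hψeq⟩ := exists_archPrime_eq_div_sub_primePole hp1 ℓ hn.1
      have e : (2 * π * I * n / Real.log p : ℂ) = zP n := rfl
      rw [e] at hV hψv hψeq
      have hW : {w : ℂ | w ≠ 0} ∈ 𝓝 (zP n) := isOpen_ne.mem_nhds (hzP_ne n hn.1)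
      refine ⟨fun z => ψ z - Q z * (z - zP n), V ∩ {w : ℂ | w ≠ 0}, inter_mem hV hW, ?_, ?_, ?_⟩
      · intro z hz
        exact ((hψd z hz.1).mono inter_subset_left).sub (((hQdiff z hz.2).mul
          (differentiableAt_id.sub (differentiableAt_const _))).differentiableWithinAt)
      · simp only [sub_self, mul_zero, sub_zero]
        rw [hrP n hn.1, hψv]
      · intro z hz hzq
        have hzq' : z - zP n ≠ 0 := sub_ne_zero.2 hzq
        rw [hGQ, hF]
        dsimp only
        rw [hψeq z hz.1 hzq]
        field_simp
    · -- the double pole at `0`, split off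
      rw [Finset.mem_singleton] at hq
      subst hq
      obtain ⟨ψ, W, hW, hψd, hψ0, hψeq⟩ := hab
      refine ⟨ψ, W, hW, hψd, by rw [hψ0, hr0], ?_⟩
      intro z hz hz0
      rw [hG]
      exact hψeq z hz hz0
  -- the residue theorem for `G`
  have key := Literature.Analysis.Complex.rectBoundaryIntegral_eq_sum_of_simplePoles hab' hcd S G r U
    hUo hKU hSsub hGdiff hpole
  -- continuity on the boundary (no pole there)
  have hbdry : ∀ z : ℂ, (z.re = aj ∨ z.re = 1 / 2 ∨ |z.im| = R) → z.re ∈ Icc aj (1 / 2) →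
      |z.im| ≤ R → z ≠ 0 ∧ DifferentiableAt ℂ F z := by
    intro z hz hzre hzim
    have hzU : z ∈ U := hKU (by
      rw [mem_reProdIm, mem_Icc]; exact ⟨hzre, abs_le.1 hzim⟩)
    have hzS : z ∉ (S : Set ℂ) := by
      intro h
      have h' := hSsub h
      rw [mem_reProdIm, mem_Ioo, mem_Ioo] at h'
      rcases hz with hz | hz | hz
      · linarith [h'.1.1]
      · linarith [h'.1.2]
      · have := abs_lt.2 ⟨h'.2.1, h'.2.2⟩; linarith
    have hz0 : z ≠ 0 := by
      intro h; apply hzS; rw [h, hS]; simp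
    exact ⟨hz0, hFdiff z hzU hzS⟩
  have hcontF : ∀ z : ℂ, (z.re = aj ∨ z.re = 1 / 2 ∨ |z.im| = R) → z.re ∈ Icc aj (1 / 2) →
      |z.im| ≤ R → ContinuousAt F z := fun z h1 h2 h3 => (hbdry z h1 h2 h3).2.continuousAt
  have hcontQ : ∀ z : ℂ, (z.re = aj ∨ z.re = 1 / 2 ∨ |z.im| = R) → z.re ∈ Icc aj (1 / 2) →
      |z.im| ≤ R → ContinuousAt Q z := fun z h1 h2 h3 => (hQdiff z (hbdry z h1 h2 h3).1).continuousAt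
  have hcontG : ∀ z : ℂ, (z.re = aj ∨ z.re = 1 / 2 ∨ |z.im| = R) → z.re ∈ Icc aj (1 / 2) →
      |z.im| ≤ R → ContinuousAt G z := by
    intro z h1 h2 h3
    have : G = fun w => F w - Q w := funext hGQ
    rw [this]
    exact (hcontF z h1 h2 h3).sub (hcontQ z h1 h2 h3)
  -- points of the four sides
  have hreim : ∀ x y : ℝ, ((x : ℂ) + y * I).re = x ∧ ((x : ℂ) + y * I).im = y := by
    intro x y; constructor <;> simp
  have hbot : ∀ x ∈ Icc aj (1 / 2), ((x : ℂ) + (-R : ℝ) * I).re ∈ Icc aj (1 / 2) ∧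
      |((x : ℂ) + (-R : ℝ) * I).im| ≤ R ∧ |((x : ℂ) + (-R : ℝ) * I).im| = R := by
    intro x hx
    rw [(hreim x (-R)).1, (hreim x (-R)).2, abs_neg, abs_of_pos hR0]
    exact ⟨hx, le_rfl, rfl⟩
  have htop : ∀ x ∈ Icc aj (1 / 2), ((x : ℂ) + (R : ℝ) * I).re ∈ Icc aj (1 / 2) ∧
      |((x : ℂ) + (R : ℝ) * I).im| ≤ R ∧ |((x : ℂ) + (R : ℝ) * I).im| = R := by
    intro x hx
    rw [(hreim x R).1, (hreim x R).2, abs_of_pos hR0]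
    exact ⟨hx, le_rfl, rfl⟩
  have hleft : ∀ y ∈ Icc (-R) R, ((aj : ℂ) + y * I).re ∈ Icc aj (1 / 2) ∧
      |((aj : ℂ) + y * I).im| ≤ R ∧ ((aj : ℂ) + y * I).re = aj := by
    intro y hy
    rw [(hreim aj y).1, (hreim aj y).2]
    exact ⟨⟨le_rfl, hab'.le⟩, abs_le.2 ⟨hy.1, hy.2⟩, rfl⟩
  have hright : ∀ y ∈ Icc (-R) R, ((((1 / 2 : ℝ)) : ℂ) + y * I).re ∈ Icc aj (1 / 2) ∧
      |((((1 / 2 : ℝ)) : ℂ) + y * I).im| ≤ R ∧ ((((1 / 2 : ℝ)) : ℂ) + y * I).re = 1 / 2 := by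
    intro y hy
    rw [(hreim (1 / 2) y).1, (hreim (1 / 2) y).2]
    exact ⟨⟨hab'.le, le_rfl⟩, abs_le.2 ⟨hy.1, hy.2⟩, rfl⟩
  -- `∮F = ∮G + ∮Q`, `∮Q = ∮az⁻² + ∮bz⁻¹ = 0 + 2πib`
  have hFGQ : F = fun z => G z + Q z := by
    funext z; rw [hGQ]; ring
  have hsplit1 := Literature.Analysis.Complex.rectBoundaryIntegral_add (F := G) (G := Q) hab'.le hcd.le
    (fun x hx => hcontG _ (Or.inr (Or.inr (hbot x hx).2.2)) (hbot x hx).1 (hbot x hx).2.1)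
    (fun x hx => hcontG _ (Or.inr (Or.inr (htop x hx).2.2)) (htop x hx).1 (htop x hx).2.1)
    (fun y hy => hcontG _ (Or.inl (hleft y hy).2.2) (hleft y hy).1 (hleft y hy).2.1)
    (fun y hy => hcontG _ (Or.inr (Or.inl (hright y hy).2.2)) (hright y hy).1 (hright y hy).2.1)
    (fun x hx => hcontQ _ (Or.inr (Or.inr (hbot x hx).2.2)) (hbot x hx).1 (hbot x hx).2.1)
    (fun x hx => hcontQ _ (Or.inr (Or.inr (htop x hx).2.2)) (htop x hx).1 (htop x hx).2.1)
    (fun y hy => hcontQ _ (Or.inl (hleft y hy).2.2) (hleft y hy).1 (hleft y hy).2.1)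
    (fun y hy => hcontQ _ (Or.inr (Or.inl (hright y hy).2.2)) (hright y hy).1 (hright y hy).2.1)
  have hQ1 : ∀ z : ℂ, z ≠ 0 → ContinuousAt (fun w : ℂ => a / w ^ 2) z := fun z hz =>
    (hQa z hz).continuousAt
  have hQ2 : ∀ z : ℂ, z ≠ 0 → ContinuousAt (fun w : ℂ => b / w) z := fun z hz =>
    (hQb z hz).continuousAt
  have hsplit2 := Literature.Analysis.Complex.rectBoundaryIntegral_add (F := fun w : ℂ => a / w ^ 2)
    (G := fun w : ℂ => b / w) hab'.le hcd.le
    (fun x hx => hQ1 _ (hbdry _ (Or.inr (Or.inr (hbot x hx).2.2)) (hbot x hx).1 (hbot x hx).2.1).1)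
    (fun x hx => hQ1 _ (hbdry _ (Or.inr (Or.inr (htop x hx).2.2)) (htop x hx).1 (htop x hx).2.1).1)
    (fun y hy => hQ1 _ (hbdry _ (Or.inl (hleft y hy).2.2) (hleft y hy).1 (hleft y hy).2.1).1)
    (fun y hy => hQ1 _ (hbdry _ (Or.inr (Or.inl (hright y hy).2.2)) (hright y hy).1 (hright y hy).2.1).1)
    (fun x hx => hQ2 _ (hbdry _ (Or.inr (Or.inr (hbot x hx).2.2)) (hbot x hx).1 (hbot x hx).2.1).1)
    (fun x hx => hQ2 _ (hbdry _ (Or.inr (Or.inr (htop x hx).2.2)) (htop x hx).1 (htop x hx).2.1).1)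
    (fun y hy => hQ2 _ (hbdry _ (Or.inl (hleft y hy).2.2) (hleft y hy).1 (hleft y hy).2.1).1)
    (fun y hy => hQ2 _ (hbdry _ (Or.inr (Or.inl (hright y hy).2.2)) (hright y hy).1 (hright y hy).2.1).1)
  have hQsum : (Q : ℂ → ℂ) = fun w => a / w ^ 2 + b / w := by rw [hQ]
  have hinvsq := ap_rectBoundaryIntegral_div_sq a haj0 (by norm_num : (0:ℝ) < 1 / 2) (neg_lt_zero.2 hR0) hR0
  have hinv : Literature.Analysis.Complex.rectBoundaryIntegral (fun w : ℂ => b / w) aj (1 / 2) (-R) R =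
      2 * π * I * b := by
    have e : (fun w : ℂ => b / w) = fun w => b * (w - 0)⁻¹ := by
      funext w; rw [sub_zero, div_eq_mul_inv]
    rw [e]
    exact Literature.Analysis.Complex.rectBoundaryIntegral_const_mul_inv_sub b 0
      (by simp; exact haj0) (by simp) (by simp; exact hR0) (by simp; exact hR0)
  rw [hFGQ, hsplit1, key, hQsum, hsplit2, hinvsq, hinv, zero_add]
  -- the sum of the residues
  have hdisj1 : Disjoint SA SP := by
    rw [Finset.disjoint_left]
    intro z hz1 hz2
    rw [hSA, Finset.mem_image] at hz1
    rw [hSP, Finset.mem_image] at hz2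
    obtain ⟨n, -, rfl⟩ := hz1
    obtain ⟨k, hk, hk'⟩ := hz2
    rw [Finset.mem_erase] at hk
    have := congrArg Complex.im hk'
    rw [hzA_im] at this
    exact hzP_im_ne k hk.1 this
  have hdisj2 : Disjoint (SA ∪ SP) {0} := by
    rw [Finset.disjoint_singleton_right, Finset.mem_union, not_or]
    constructor
    · rw [hSA, Finset.mem_image]
      rintro ⟨n, hn, h⟩
      rw [Finset.mem_Ico] at hn
      have := congrArg Complex.re h
      rw [hzA_re] at this
      simp at this
      omega
    · rw [hSP, Finset.mem_image]
      rintro ⟨n, hn, h⟩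
      rw [Finset.mem_erase] at hn
      exact hzP_ne n hn.1 h
  rw [hS, Finset.sum_union hdisj2, Finset.sum_union hdisj1, Finset.sum_singleton, hr0, add_zero,
    hSA, Finset.sum_image fun u _ v _ h => hzA_inj h, hSP, Finset.sum_image fun u _ v _ h => hzP_inj h,
    Finset.sum_congr rfl fun n hn => hrA n (Finset.mem_Ico.1 hn).1,
    Finset.sum_congr rfl fun n hn => hrP n (Finset.mem_erase.1 hn).1]
  ring

end Rectangle

/-! ### E. Letting `m → ∞` (fixed width `2j`): the strip identity with the full series of `ρ_p`-residues -/

section StripLimit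

/-- RH-FREE. `|2z − 3|² = (2 Re z − 3)² + 4 (Im z)²`. [folklore] -/
private theorem ap_normSq_two_mul_sub_three (z : ℂ) :
    ‖2 * z - 3‖ ^ 2 = (2 * z.re - 3) ^ 2 + 4 * z.im ^ 2 := by
  rw [Complex.sq_norm, normSq_apply]
  simp
  ring

/-- RH-FREE. For `Re z ≤ ½`: `|2z − 3|² ≥ 4(1 + (Im z)²)`. [folklore] -/
private theorem ap_four_mul_le_normSq {z : ℂ} (hz : z.re ≤ 1 / 2) : 4 * (1 + z.im ^ 2) ≤ ‖2 * z - 3‖ ^ 2 := by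
  rw [ap_normSq_two_mul_sub_three]
  nlinarith

/-- RH-FREE. The pointwise bound `|F_ℓ(z)| ≤ |ρ_∞(z)||ρ_p(z)|/|2z−3|²` on `Re z ≤ ½`. [folklore] -/
private theorem ap_norm_F_le {p : ℕ} (ℓ : ℕ) {z : ℂ} (hz : z.re ≤ 1 / 2) :
    ‖rhoArch z * rhoPrime p z * ((2 * z + 1) ^ ℓ / (2 * z - 3) ^ (ℓ + 2))‖ ≤
      ‖rhoArch z‖ * ‖rhoPrime p z‖ * (‖2 * z - 3‖ ^ 2)⁻¹ := by
  rw [norm_mul, norm_mul]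
  exact mul_le_mul_of_nonneg_left (norm_ratFactor_le hz ℓ) (by positivity)

/-- RH-FREE. `F_ℓ` is continuous along a vertical line `Re z = c ≤ ½` with `c ∉ −2ℕ`, `c ≠ 0`. [folklore] -/
private theorem ap_continuous_F_vertical {p : ℕ} (hp : 1 < p) (ℓ : ℕ) {c : ℝ} (hc : ∀ n : ℕ, c ≠ -(2 * n))
    (hc0 : c ≠ 0) (hc1 : c ≤ 1 / 2) :
    Continuous fun y : ℝ => rhoArch ((c : ℂ) + y * I) * rhoPrime p ((c : ℂ) + y * I) *
      ((2 * ((c : ℂ) + y * I) + 1) ^ ℓ / (2 * ((c : ℂ) + y * I) - 3) ^ (ℓ + 2)) := by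
  refine continuous_iff_continuousAt.2 fun y => ?_
  have hG : Gammaℝ ((c : ℂ) + y * I) ≠ 0 := ap_Gammaℝ_ne_zero_of_re_ne (by simp; exact hc)
  have hre : ((c : ℂ) + y * I).re ≠ 0 := by simp; exact hc0
  have hre' : ((c : ℂ) + y * I).re < 3 / 2 := by simp; linarith
  have hline : Continuous fun y : ℝ => (c : ℂ) + y * I := by fun_prop
  exact ContinuousAt.comp
    (g := fun w : ℂ => rhoArch w * rhoPrime p w * ((2 * w + 1) ^ ℓ / (2 * w - 3) ^ (ℓ + 2)))
    (f := fun y : ℝ => (c : ℂ) + y * I) (x := y) (ap_differentiableAt_F hp ℓ hG hre hre').continuousAt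
    hline.continuousAt

/-- RH-FREE. Integrability of `F_ℓ` along a vertical line `Re z = c ≤ ½` (no pole on it) on which
`|ρ_∞ρ_p| ≤ B`. [folklore] -/
private theorem ap_integrable_F_vertical {p : ℕ} (hp : 1 < p) (ℓ : ℕ) {c B : ℝ}
    (hc : ∀ n : ℕ, c ≠ -(2 * n)) (hc0 : c ≠ 0) (hc1 : c ≤ 1 / 2)
    (hB : ∀ y : ℝ, ‖rhoArch ((c : ℂ) + y * I)‖ * ‖rhoPrime p ((c : ℂ) + y * I)‖ ≤ B) :
    Integrable fun y : ℝ => rhoArch ((c : ℂ) + y * I) * rhoPrime p ((c : ℂ) + y * I) *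
      ((2 * ((c : ℂ) + y * I) + 1) ^ ℓ / (2 * ((c : ℂ) + y * I) - 3) ^ (ℓ + 2)) := by
  have hB0 : 0 ≤ B := le_trans (by positivity) (hB 0)
  refine Integrable.mono' (integrable_inv_one_add_sq.const_mul (B / 4))
    (ap_continuous_F_vertical hp ℓ hc hc0 hc1).aestronglyMeasurable (Eventually.of_forall fun y => ?_)
  have hre : ((c : ℂ) + y * I).re ≤ 1 / 2 := by simpa using hc1
  have h4 := ap_four_mul_le_normSq hre
  simp only [add_im, ofReal_im, mul_im, ofReal_re, I_im, mul_one, I_re, mul_zero, add_zero, zero_add] at h4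
  calc ‖rhoArch ((c : ℂ) + y * I) * rhoPrime p ((c : ℂ) + y * I) *
        ((2 * ((c : ℂ) + y * I) + 1) ^ ℓ / (2 * ((c : ℂ) + y * I) - 3) ^ (ℓ + 2))‖
      ≤ ‖rhoArch ((c : ℂ) + y * I)‖ * ‖rhoPrime p ((c : ℂ) + y * I)‖ * (‖2 * ((c : ℂ) + y * I) - 3‖ ^ 2)⁻¹ :=
        ap_norm_F_le ℓ hre
    _ ≤ B * (4 * (1 + y ^ 2))⁻¹ :=
        mul_le_mul (hB y) (inv_anti₀ (by positivity) h4) (by positivity) hB0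
    _ = B / 4 * (1 + y ^ 2)⁻¹ := by rw [mul_inv]; ring

/-- RH-FREE. **The residues at the poles of `ρ_p` are absolutely summable** (`|ρ_∞(2πin/log p)|` is
bounded — indeed `O(|n|^{−1/2})`, Lemma 4.3 — and `|K_ℓ(2πin/log p)| = O(n^{−2})`).
[cite: ConnesConsani2021QuasiInner, Thm 4.4 proof (arXiv chunk p0012:L9–L18) with eq. (4.2) (p0011:L65)] -/
theorem summable_archPrime_primeResidues {p : ℕ} (hp : 1 < p) (ℓ : ℕ) :
    Summable fun n : ℤ => if n = 0 then (0 : ℂ) else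
      rhoArch (2 * π * I * n / Real.log p) * ((1 - (p : ℂ)⁻¹) / Real.log p *
        ((2 * (2 * π * I * n / Real.log p) + 1) ^ ℓ / (2 * (2 * π * I * n / Real.log p) - 3) ^ (ℓ + 2))) := by
  have hlogR : 0 < Real.log p := Real.log_pos (by exact_mod_cast hp)
  obtain ⟨K, hK, hKb⟩ := exists_norm_rhoArch_le_of_two_le_abs_im (0 : ℝ)
  have hs := (summable_residues_rhoPrime_kernel hp ℓ).norm.mul_left (K / 8)
  refine Summable.of_norm_bounded_eventually hs ?_
  -- for `|n| ≥ N₀` (`2π|n|/log p ≥ 2`) the Stirling bound applies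
  obtain ⟨N₀, hN₀⟩ := exists_nat_ge (Real.log p / π)
  rw [Filter.eventually_cofinite]
  refine (Set.finite_Icc (-(N₀ : ℤ)) N₀).subset fun n hn => ?_
  rw [mem_Icc]
  by_contra hout
  apply hn
  have hn2 : (N₀ : ℝ) < |(n : ℝ)| := by
    rw [← Int.cast_abs]
    have : (N₀ : ℤ) < |n| := by
      rcases not_and_or.1 hout with h | h
      · have := not_le.1 h; rw [abs_of_neg (by omega)]; omega
      · have := not_le.1 h; rw [abs_of_pos (by omega)]; omega
    exact_mod_cast this
  have hn0 : n ≠ 0 := by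
    rintro rfl
    simp at hn2
    linarith [N₀.cast_nonneg (α := ℝ)]
  rw [if_neg hn0]
  set zn : ℂ := 2 * π * I * n / Real.log p with hzn
  have hzn' : zn = ((0 : ℝ) : ℂ) + (2 * π * n / Real.log p : ℝ) * I := by
    rw [hzn]; push_cast; ring
  have him : 2 ≤ |(2 * π * n / Real.log p : ℝ)| := by
    rw [abs_div, abs_of_pos hlogR, le_div_iff₀ hlogR, abs_mul, abs_of_pos (by positivity : (0:ℝ) < 2 * π)]
    have : Real.log p / π * π = Real.log p := div_mul_cancel₀ _ Real.pi_ne_zero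
    nlinarith [Real.pi_pos, hN₀]
  have hrho : ‖rhoArch zn‖ ≤ K := by
    rw [hzn']
    exact hKb 0 (by norm_num) _ him
  have hK' : rhoArch zn * ((1 - (p : ℂ)⁻¹) / Real.log p *
      ((2 * zn + 1) ^ ℓ / (2 * zn - 3) ^ (ℓ + 2))) = rhoArch zn * (-(1 / 8 : ℂ)) *
      (8 * (1 - (p : ℂ)⁻¹) * Real.log p / (4 * π * n + 3 * I * Real.log p) ^ 2 * xPrime p n ^ ℓ) := by
    rw [← residueCoeff_eq hp n ℓ, ← hzn, ap_kernel_eq]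
    ring
  rw [hK', norm_mul, norm_mul]
  have : ‖(-(1 / 8 : ℂ))‖ = 1 / 8 := by simp
  rw [this]
  calc ‖rhoArch zn‖ * (1 / 8) * ‖8 * (1 - (p : ℂ)⁻¹) * Real.log p / (4 * π * n + 3 * I * Real.log p) ^ 2 *
        xPrime p n ^ ℓ‖ ≤ K * (1 / 8) * ‖8 * (1 - (p : ℂ)⁻¹) * Real.log p /
          (4 * π * n + 3 * I * Real.log p) ^ 2 * xPrime p n ^ ℓ‖ := by gcongr
    _ = K / 8 * ‖8 * (1 - (p : ℂ)⁻¹) * Real.log p / (4 * π * n + 3 * I * Real.log p) ^ 2 *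
          xPrime p n ^ ℓ‖ := by ring

/-- RH-FREE. **The strip identity for `ρ_∞ρ_p`** (the rectangles of `rectBoundaryIntegral_archPrime`,
`m → ∞`: the horizontal sides `Im z = ±(2m+1)π/log p` tend to `0` — «the same control as in Section 2 of
the integral on the segment `(½ + iR, ½ − 2m + iR)` by `π/8R`», here `|ρ_∞| ≤ K`, `|ρ_p| ≤ 1`,
`|K_ℓ| ≤ 1/4R²` — while the vertical sides converge absolutely):
`∫_ℝ F_ℓ(½+iy)dy − ∫_ℝ F_ℓ(½−2j+iy)dy = 2π[Σ_{1≤n<j} Res_{−2n} + Σ_{n≠0} Res_{2πin/log p} + b]`.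
[cite: ConnesConsani2021QuasiInner, Thm 4.4 proof (arXiv chunks p0011:L104–p0012:L9)] -/
theorem integral_archPrime_line_sub_eq {p : ℕ} (hp : p.Prime) (ℓ : ℕ) {a b : ℂ}
    (hab : ∃ ψ : ℂ → ℂ, ∃ W ∈ 𝓝 (0 : ℂ), DifferentiableOn ℂ ψ W ∧ ψ 0 = 0 ∧
      ∀ z ∈ W, z ≠ 0 →
        rhoArch z * rhoPrime p z * ((2 * z + 1) ^ ℓ / (2 * z - 3) ^ (ℓ + 2)) - a / z ^ 2 - b / z =
          ψ z / (z - 0))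
    {j : ℕ} (hj : 1 ≤ j) :
    (∫ y : ℝ, rhoArch ((((1 / 2 : ℝ)) : ℂ) + y * I) * rhoPrime p ((((1 / 2 : ℝ)) : ℂ) + y * I) *
        ((2 * ((((1 / 2 : ℝ)) : ℂ) + y * I) + 1) ^ ℓ / (2 * ((((1 / 2 : ℝ)) : ℂ) + y * I) - 3) ^ (ℓ + 2))) -
      ∫ y : ℝ, rhoArch ((((1 / 2 - 2 * j : ℝ)) : ℂ) + y * I) *
        rhoPrime p ((((1 / 2 - 2 * j : ℝ)) : ℂ) + y * I) *
        ((2 * ((((1 / 2 - 2 * j : ℝ)) : ℂ) + y * I) + 1) ^ ℓ /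
          (2 * ((((1 / 2 - 2 * j : ℝ)) : ℂ) + y * I) - 3) ^ (ℓ + 2)) =
      2 * π *
        ((∑ n ∈ Finset.Ico 1 j,
            ((((-1 : ℝ) ^ n * 2 * (Real.sqrt π * π ^ (2 * n)) / (n ! * Real.Gamma (n + 1 / 2)) : ℝ)) : ℂ) *
              (rhoPrime p (-(2 * (n : ℂ))) *
                ((2 * (-(2 * (n : ℂ))) + 1) ^ ℓ / (2 * (-(2 * (n : ℂ))) - 3) ^ (ℓ + 2)))) +
          (∑' n : ℤ, if n = 0 then (0 : ℂ) else
            rhoArch (2 * π * I * n / Real.log p) * ((1 - (p : ℂ)⁻¹) / Real.log p *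
              ((2 * (2 * π * I * n / Real.log p) + 1) ^ ℓ /
                (2 * (2 * π * I * n / Real.log p) - 3) ^ (ℓ + 2)))) + b) := by
  have hp1 : 1 < p := hp.one_lt
  have hp1R : (1 : ℝ) < p := by exact_mod_cast hp1
  have hlogR : 0 < Real.log p := Real.log_pos hp1R
  have hj1 : (1 : ℝ) ≤ j := by exact_mod_cast hj
  set aj : ℝ := 1 / 2 - 2 * j with haj
  have haj0 : aj < 0 := by rw [haj]; linarith
  set F : ℂ → ℂ := fun z => rhoArch z * rhoPrime p z * ((2 * z + 1) ^ ℓ / (2 * z - 3) ^ (ℓ + 2)) with hF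
  -- the residue series
  set T : ℤ → ℂ := fun n => if n = 0 then (0 : ℂ) else
      rhoArch (2 * π * I * n / Real.log p) * ((1 - (p : ℂ)⁻¹) / Real.log p *
        ((2 * (2 * π * I * n / Real.log p) + 1) ^ ℓ / (2 * (2 * π * I * n / Real.log p) - 3) ^ (ℓ + 2)))
    with hT
  have hsum : Summable T := summable_archPrime_primeResidues hp1 ℓ
  set A : ℂ := ∑ n ∈ Finset.Ico 1 j,
      ((((-1 : ℝ) ^ n * 2 * (Real.sqrt π * π ^ (2 * n)) / (n ! * Real.Gamma (n + 1 / 2)) : ℝ)) : ℂ) *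
        (rhoPrime p (-(2 * (n : ℂ))) * ((2 * (-(2 * (n : ℂ))) + 1) ^ ℓ / (2 * (-(2 * (n : ℂ))) - 3) ^ (ℓ + 2)))
    with hA
  -- (i) the partial sums over `0 < |n| ≤ m` converge to the sum of the series
  have h_partial : Tendsto (fun m : ℕ => ∑ n ∈ (Finset.Icc (-(m : ℤ)) m).erase 0,
      rhoArch (2 * π * I * n / Real.log p) * ((1 - (p : ℂ)⁻¹) / Real.log p *
        ((2 * (2 * π * I * n / Real.log p) + 1) ^ ℓ / (2 * (2 * π * I * n / Real.log p) - 3) ^ (ℓ + 2))))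
      atTop (𝓝 (∑' n : ℤ, T n)) := by
    have h := hsum.hasSum.comp Finset.tendsto_Icc_neg
    refine h.congr fun m => ?_
    simp only [Function.comp]
    rw [← Finset.sum_erase (Finset.Icc (-(m : ℤ)) m) (f := T) (a := 0) (by rw [hT]; simp)]
    refine Finset.sum_congr rfl fun n hn => ?_
    rw [hT]
    dsimp only
    rw [if_neg (Finset.mem_erase.1 hn).1]
  -- (ii) the height `R_m → ∞`
  have hR : Tendsto (fun m : ℕ => (2 * (m : ℝ) + 1) * π / Real.log p) atTop atTop :=
    ((tendsto_atTop_add_const_right _ _ (tendsto_natCast_atTop_atTop.const_mul_atTop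
      (by norm_num : (0 : ℝ) < 2))).atTop_mul_const Real.pi_pos).atTop_div_const hlogR
  -- bounds for `ρ_∞`, `ρ_p`
  obtain ⟨K, hK, hKb⟩ := exists_norm_rhoArch_le_of_two_le_abs_im aj
  have hcp : 0 ≤ (1 + (p : ℝ)⁻¹) / ((p : ℝ) ^ (3 / 2 : ℝ) - 1) := by
    have : 1 < (p : ℝ) ^ (3 / 2 : ℝ) := Real.one_lt_rpow hp1R (by norm_num)
    exact div_nonneg (by positivity) (by linarith)
  -- no pole on the vertical lines
  have hc_half : ∀ n : ℕ, (1 / 2 : ℝ) ≠ -(2 * n) := by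
    intro n h; linarith [n.cast_nonneg (α := ℝ)]
  have hc_aj : ∀ n : ℕ, aj ≠ -(2 * n) := by
    intro n h
    rw [haj] at h
    have h2 : (1 : ℝ) = 4 * ((j : ℝ) - n) := by linarith
    have h3 : (1 : ℤ) = 4 * ((j : ℤ) - n) := by exact_mod_cast h2
    omega
  -- (iii) the right side converges to the line integral
  have hint_right : Integrable fun y : ℝ => F ((((1 / 2 : ℝ)) : ℂ) + y * I) := by
    refine ap_integrable_F_vertical hp1 ℓ (B := 1) hc_half (by norm_num) le_rfl fun y => ?_
    rw [show ((((1 / 2 : ℝ)) : ℂ)) + (y : ℂ) * I = 1 / 2 + y * I by push_cast; ring,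
      norm_rhoArch_critical_line, norm_rhoPrime_critical_line hp1, mul_one]
  have h_right : Tendsto (fun m : ℕ =>
      ∫ y in (-((2 * m + 1) * π / Real.log p))..((2 * m + 1) * π / Real.log p),
        F ((((1 / 2 : ℝ)) : ℂ) + y * I)) atTop (𝓝 (∫ y : ℝ, F ((((1 / 2 : ℝ)) : ℂ) + y * I))) :=
    intervalIntegral_tendsto_integral hint_right (tendsto_neg_atTop_atBot.comp hR) hR
  -- (iv) the left side converges to the line integral
  have hBleft : ∀ y : ℝ, ‖rhoArch ((aj : ℂ) + y * I)‖ * ‖rhoPrime p ((aj : ℂ) + y * I)‖ ≤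
      (16 * π ^ 2 / 3) ^ min j 3 * ((1 + (p : ℝ)⁻¹) / ((p : ℝ) ^ (3 / 2 : ℝ) - 1)) := by
    intro y
    refine mul_le_mul (norm_rhoArch_leftLine_le j y) (norm_rhoPrime_le_of_re_le hp1 (by norm_num)
      (by simp; rw [haj]; linarith)) (norm_nonneg _) (by positivity)
  have hint_left : Integrable fun y : ℝ => F ((aj : ℂ) + y * I) :=
    ap_integrable_F_vertical hp1 ℓ hc_aj haj0.ne (by linarith) hBleft
  have h_left : Tendsto (fun m : ℕ =>
      ∫ y in (-((2 * m + 1) * π / Real.log p))..((2 * m + 1) * π / Real.log p),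
        F ((aj : ℂ) + y * I)) atTop (𝓝 (∫ y : ℝ, F ((aj : ℂ) + y * I))) :=
    intervalIntegral_tendsto_integral hint_left (tendsto_neg_atTop_atBot.comp hR) hR
  -- (v) the horizontal sides tend to `0`
  have h_small : Tendsto (fun m : ℕ => K * (2 * j) / (4 * ((2 * (m : ℝ) + 1) * π / Real.log p) ^ 2))
      atTop (𝓝 0) := by
    have h2 : Tendsto (fun m : ℕ => 4 * ((2 * (m : ℝ) + 1) * π / Real.log p) ^ 2) atTop atTop :=
      Tendsto.const_mul_atTop (by norm_num) (Tendsto.atTop_mul_atTop₀ hR hR |>.congr fun m => by ring)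
    exact tendsto_const_nhds.div_atTop h2
  have hhor : ∀ m : ℕ, 2 ≤ (2 * (m : ℝ) + 1) * π / Real.log p → ∀ (s : ℝ), |s| = (2 * (m : ℝ) + 1) * π / Real.log p →
      (∃ k : ℤ, s = (2 * k + 1) * π / Real.log p) →
      ‖∫ x in aj..(1 / 2 : ℝ), F ((x : ℂ) + (s : ℂ) * I)‖ ≤
        K * (2 * j) / (4 * ((2 * (m : ℝ) + 1) * π / Real.log p) ^ 2) := by
    intro m hm2 s hs hk
    obtain ⟨k, hk⟩ := hk
    set Rm : ℝ := (2 * (m : ℝ) + 1) * π / Real.log p with hRm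
    have hRm0 : 0 < Rm := by positivity
    have hbound : ∀ x ∈ Ι aj (1 / 2 : ℝ), ‖F ((x : ℂ) + (s : ℂ) * I)‖ ≤ K / (4 * Rm ^ 2) := by
      intro x hx
      rw [Set.uIoc_of_le (by linarith)] at hx
      have hxre : ((x : ℂ) + (s : ℂ) * I).re ≤ 1 / 2 := by
        have : ((x : ℂ) + (s : ℂ) * I).re = x := by simp
        rw [this]; exact hx.2
      have h1 : ‖rhoArch ((x : ℂ) + (s : ℂ) * I)‖ ≤ K := hKb x ⟨hx.1.le, hx.2⟩ s (by rw [hs]; exact hm2)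
      have h2 : ‖rhoPrime p ((x : ℂ) + (s : ℂ) * I)‖ ≤ 1 := by
        rw [hk]
        exact norm_rhoPrime_le_one_of_re_le_half hp1 k hx.2
      have h3 : (‖2 * ((x : ℂ) + (s : ℂ) * I) - 3‖ ^ 2)⁻¹ ≤ (4 * Rm ^ 2)⁻¹ := by
        refine inv_anti₀ (by positivity) ?_
        have h4 := ap_four_mul_le_normSq hxre
        simp only [add_im, ofReal_im, mul_im, ofReal_re, I_im, mul_one, I_re, mul_zero, add_zero,
          zero_add] at h4
        have : s ^ 2 = Rm ^ 2 := by rw [← sq_abs, hs]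
        nlinarith
      calc ‖F ((x : ℂ) + (s : ℂ) * I)‖ ≤ ‖rhoArch ((x : ℂ) + (s : ℂ) * I)‖ *
            ‖rhoPrime p ((x : ℂ) + (s : ℂ) * I)‖ * (‖2 * ((x : ℂ) + (s : ℂ) * I) - 3‖ ^ 2)⁻¹ :=
            ap_norm_F_le ℓ hxre
        _ ≤ K * 1 * (4 * Rm ^ 2)⁻¹ :=
            mul_le_mul (mul_le_mul h1 h2 (norm_nonneg _) hK.le) h3 (by positivity) (by positivity)
        _ = K / (4 * Rm ^ 2) := by ring
    refine (intervalIntegral.norm_integral_le_of_norm_le_const hbound).trans (le_of_eq ?_)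
    rw [haj, show |1 / 2 - (1 / 2 - 2 * (j : ℝ))| = 2 * j by rw [abs_of_nonneg (by linarith)]; ring]
    field_simp
  obtain ⟨m₀, hm₀⟩ : ∃ m₀ : ℕ, ∀ m : ℕ, m₀ ≤ m → 2 ≤ (2 * (m : ℝ) + 1) * π / Real.log p := by
    have := (hR.eventually (eventually_ge_atTop 2))
    rw [eventually_atTop] at this
    exact this
  have h_top : Tendsto (fun m : ℕ => ∫ x in aj..(1 / 2 : ℝ),
      F ((x : ℂ) + (((2 * m + 1) * π / Real.log p : ℝ) : ℂ) * I)) atTop (𝓝 0) := by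
    refine squeeze_zero_norm' ?_ h_small
    filter_upwards [eventually_ge_atTop m₀] with m hm
    exact hhor m (hm₀ m hm) _ (abs_of_pos (by positivity)) ⟨m, by push_cast; ring⟩
  have h_bot : Tendsto (fun m : ℕ => ∫ x in aj..(1 / 2 : ℝ),
      F ((x : ℂ) + ((-((2 * m + 1) * π / Real.log p) : ℝ) : ℂ) * I)) atTop (𝓝 0) := by
    refine squeeze_zero_norm' ?_ h_small
    filter_upwards [eventually_ge_atTop m₀] with m hm
    refine hhor m (hm₀ m hm) _ (by rw [abs_neg, abs_of_pos (by positivity)]) ⟨-(m : ℤ) - 1, ?_⟩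
    push_cast; ring
  -- (vi) the boundary integrals converge …
  have h_box : Tendsto (fun m : ℕ => Literature.Analysis.Complex.rectBoundaryIntegral F aj (1 / 2)
        (-((2 * m + 1) * π / Real.log p)) ((2 * m + 1) * π / Real.log p))
      atTop (𝓝 (0 - 0 + I * (∫ y : ℝ, F ((((1 / 2 : ℝ)) : ℂ) + y * I)) -
        I * (∫ y : ℝ, F ((aj : ℂ) + y * I)))) := by
    have h := ((h_bot.sub h_top).add (h_right.const_mul I)).sub (h_left.const_mul I)
    refine h.congr fun m => ?_
    rw [Literature.Analysis.Complex.rectBoundaryIntegral_def]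
  -- (vii) … and by the residue formula they are `2πi` times the partial sums
  have h_val : Tendsto (fun m : ℕ => Literature.Analysis.Complex.rectBoundaryIntegral F aj (1 / 2)
        (-((2 * m + 1) * π / Real.log p)) ((2 * m + 1) * π / Real.log p))
      atTop (𝓝 (2 * π * I * (A + (∑' n : ℤ, T n) + b))) := by
    have h := ((tendsto_const_nhds (x := A)).add h_partial).add (tendsto_const_nhds (x := b))
    have h' := h.const_mul (2 * π * I)
    refine h'.congr' ?_
    filter_upwards [eventually_ge_atTop 1] with m hm
    rw [hF, haj]
    exact (rectBoundaryIntegral_archPrime hp ℓ hab hj hm).symm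
  have h_eq := tendsto_nhds_unique h_box h_val
  rw [sub_zero, zero_add] at h_eq
  have hI : (I : ℂ) ≠ 0 := I_ne_zero
  have key : (∫ y : ℝ, F ((((1 / 2 : ℝ)) : ℂ) + y * I)) - (∫ y : ℝ, F ((aj : ℂ) + y * I)) =
      2 * π * (A + (∑' n : ℤ, T n) + b) := by
    have h3 := h_eq
    rw [← mul_sub, show 2 * (π : ℂ) * I * (A + (∑' n : ℤ, T n) + b) =
      I * (2 * π * (A + (∑' n : ℤ, T n) + b)) by ring] at h3
    exact mul_left_cancel₀ hI h3
  rw [haj] at key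
  simpa only [hF, hA, hT] using key

end StripLimit

/-! ### F. Letting `j → ∞`: the line integral over `∂ℂ₋` as the full series of residues -/

section LineLimit

/-- RH-FREE. `Γ(n + ½) ≥ ½` for every `n ∈ ℕ`. [folklore] -/
private theorem ap_half_le_Gamma_nat_add_half (n : ℕ) : (1 / 2 : ℝ) ≤ Real.Gamma ((n : ℝ) + 1 / 2) := by
  have h1 : (1 : ℝ) ≤ Real.sqrt π := by
    rw [show (1:ℝ) = Real.sqrt 1 by simp]
    exact Real.sqrt_le_sqrt (by linarith [Real.two_le_pi])
  rcases Nat.lt_or_ge n 2 with hn | hn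
  · interval_cases n
    · simp only [CharP.cast_eq_zero, zero_add, Real.Gamma_one_half_eq]; linarith
    · rw [show ((1 : ℕ) : ℝ) + 1 / 2 = 1 / 2 + 1 by norm_num, Real.Gamma_add_one (by norm_num),
        Real.Gamma_one_half_eq]; linarith
  · have h2 : (2 : ℝ) ≤ (n : ℝ) + 1 / 2 := by
      have : (2 : ℝ) ≤ n := by exact_mod_cast hn
      linarith
    have hmono := Real.Gamma_strictMonoOn_Ici.monotoneOn (Set.self_mem_Ici) (Set.mem_Ici.mpr h2) h2
    rw [Real.Gamma_two] at hmono
    linarith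

/-- RH-FREE. `|r_n| ≤ 4√π (π²)^n/n!`: the residues of `ρ_∞` decay factorially. [folklore] -/
private theorem ap_abs_res_le (n : ℕ) :
    |(-1 : ℝ) ^ n * 2 * (Real.sqrt π * π ^ (2 * n)) / (n ! * Real.Gamma (n + 1 / 2))| ≤
      4 * Real.sqrt π * (π ^ 2) ^ n / n ! := by
  have hG := ap_half_le_Gamma_nat_add_half n
  have hGpos : 0 < Real.Gamma ((n : ℝ) + 1 / 2) := by linarith
  have hfac : (0 : ℝ) < n ! := by positivity
  have hpos : 0 < 2 * (Real.sqrt π * π ^ (2 * n)) / (n ! * Real.Gamma (n + 1 / 2)) := by positivity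
  rw [show (-1 : ℝ) ^ n * 2 * (Real.sqrt π * π ^ (2 * n)) / (n ! * Real.Gamma (n + 1 / 2)) =
      (-1) ^ n * (2 * (Real.sqrt π * π ^ (2 * n)) / (n ! * Real.Gamma (n + 1 / 2))) by ring,
    abs_mul, abs_pow, abs_neg, abs_one, one_pow, one_mul, abs_of_pos hpos, pow_mul,
    div_le_div_iff₀ (by positivity) hfac]
  have key := mul_le_mul_of_nonneg_left hG
    (by positivity : (0:ℝ) ≤ 4 * Real.sqrt π * (π ^ 2) ^ n * n !)
  ring_nf at key ⊢
  linarith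

/-- RH-FREE. **The residues at the non-zero poles of `ρ_∞` are absolutely summable** («which does not
alter the strong convergence of (uinftyoff1)»: `|ρ_p(−2n)| ≤ (1+p⁻¹)/(p²−1)`, `|K_ℓ| ≤ 1`, `|r_n| ≤ 4√π π^{2n}/n!`).
[cite: ConnesConsani2021QuasiInner, Thm 4.4 proof (arXiv chunk p0012:L5–L7)] -/
theorem summable_archPrime_archResidues {p : ℕ} (hp : 1 < p) (ℓ : ℕ) :
    Summable fun k : ℕ =>
      ((((-1 : ℝ) ^ (k + 1) * 2 * (Real.sqrt π * π ^ (2 * (k + 1))) /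
          ((k + 1) ! * Real.Gamma ((k + 1 : ℕ) + 1 / 2)) : ℝ)) : ℂ) *
        (rhoPrime p (-(2 * ((k + 1 : ℕ) : ℂ))) *
          ((2 * (-(2 * ((k + 1 : ℕ) : ℂ))) + 1) ^ ℓ / (2 * (-(2 * ((k + 1 : ℕ) : ℂ))) - 3) ^ (ℓ + 2))) := by
  have hp1R : (1 : ℝ) < p := by exact_mod_cast hp
  set c : ℝ := (1 + (p : ℝ)⁻¹) / ((p : ℝ) ^ (2 : ℝ) - 1) with hc
  have hc0 : 0 ≤ c := by
    have : 1 < (p : ℝ) ^ (2 : ℝ) := Real.one_lt_rpow hp1R (by norm_num)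
    exact div_nonneg (by positivity) (by linarith)
  have hmaj : Summable fun k : ℕ => 4 * Real.sqrt π * (π ^ 2) ^ (k + 1) / (k + 1) ! * c := by
    have h := ((Real.summable_pow_div_factorial (π ^ 2)).mul_left (4 * Real.sqrt π)).mul_right c
    have h' := (summable_nat_add_iff 1).2 h
    refine h'.congr fun k => ?_
    ring
  refine Summable.of_norm_bounded hmaj fun k => ?_
  set n : ℕ := k + 1 with hn
  have hre : (-(2 * (n : ℂ))).re ≤ 1 / 2 := by simp; linarith [n.cast_nonneg (α := ℝ)]
  have hK : ‖(2 * (-(2 * (n : ℂ))) + 1) ^ ℓ / (2 * (-(2 * (n : ℂ))) - 3) ^ (ℓ + 2)‖ ≤ 1 := by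
    refine (norm_ratFactor_le hre ℓ).trans ?_
    have h4 := ap_four_mul_le_normSq hre
    have : (4 : ℝ) ≤ ‖2 * (-(2 * (n : ℂ))) - 3‖ ^ 2 := le_trans (by nlinarith [sq_nonneg (-(2 * (n : ℂ))).im]) h4
    exact inv_le_one_of_one_le₀ (by linarith)
  have hρ : ‖rhoPrime p (-(2 * (n : ℂ)))‖ ≤ c := by
    refine norm_rhoPrime_le_of_re_le hp (by norm_num) ?_
    have e : (-(2 * (n : ℂ))).re = -(2 * n) := by simp
    rw [e, hn]
    push_cast
    linarith [k.cast_nonneg (α := ℝ)]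
  rw [norm_mul, norm_mul, Complex.norm_real, Real.norm_eq_abs]
  calc |(-1 : ℝ) ^ n * 2 * (Real.sqrt π * π ^ (2 * n)) / (n ! * Real.Gamma (n + 1 / 2))| *
        (‖rhoPrime p (-(2 * (n : ℂ)))‖ * ‖(2 * (-(2 * (n : ℂ))) + 1) ^ ℓ / (2 * (-(2 * (n : ℂ))) - 3) ^ (ℓ + 2)‖)
      ≤ (4 * Real.sqrt π * (π ^ 2) ^ n / n !) * (c * 1) :=
        mul_le_mul (ap_abs_res_le n) (mul_le_mul hρ hK (norm_nonneg _) hc0) (by positivity) (by positivity)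
    _ = 4 * Real.sqrt π * (π ^ 2) ^ (k + 1) / (k + 1) ! * c := by rw [hn, mul_one]

/-- RH-FREE. **`∫_{∂ℂ₋} ρ_∞ρ_p(z)(2z+1)^ℓ(2z−3)^{−ℓ−2}` as the full series of residues** (the contour of
Section 2, `R → ∞` then `m → ∞`): `∫_ℝ F_ℓ(½+iy)dy = 2π[Σ_{n≥1} Res_{−2n} + Σ_{n≠0} Res_{2πin/log p} + b]`,
where `az⁻² + bz⁻¹` is the principal part at `0`.
[cite: ConnesConsani2021QuasiInner, Thm 4.4 proof (arXiv chunks p0011:L104–p0012:L29)] -/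
theorem integral_archPrime_criticalLine_eq_tsum {p : ℕ} (hp : p.Prime) (ℓ : ℕ) {a b : ℂ}
    (hab : ∃ ψ : ℂ → ℂ, ∃ W ∈ 𝓝 (0 : ℂ), DifferentiableOn ℂ ψ W ∧ ψ 0 = 0 ∧
      ∀ z ∈ W, z ≠ 0 →
        rhoArch z * rhoPrime p z * ((2 * z + 1) ^ ℓ / (2 * z - 3) ^ (ℓ + 2)) - a / z ^ 2 - b / z =
          ψ z / (z - 0)) :
    ∫ y : ℝ, rhoArch ((((1 / 2 : ℝ)) : ℂ) + y * I) * rhoPrime p ((((1 / 2 : ℝ)) : ℂ) + y * I) *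
        ((2 * ((((1 / 2 : ℝ)) : ℂ) + y * I) + 1) ^ ℓ / (2 * ((((1 / 2 : ℝ)) : ℂ) + y * I) - 3) ^ (ℓ + 2)) =
      2 * π *
        ((∑' k : ℕ,
            ((((-1 : ℝ) ^ (k + 1) * 2 * (Real.sqrt π * π ^ (2 * (k + 1))) /
                ((k + 1) ! * Real.Gamma ((k + 1 : ℕ) + 1 / 2)) : ℝ)) : ℂ) *
              (rhoPrime p (-(2 * ((k + 1 : ℕ) : ℂ))) *
                ((2 * (-(2 * ((k + 1 : ℕ) : ℂ))) + 1) ^ ℓ / (2 * (-(2 * ((k + 1 : ℕ) : ℂ))) - 3) ^ (ℓ + 2)))) +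
          (∑' n : ℤ, if n = 0 then (0 : ℂ) else
            rhoArch (2 * π * I * n / Real.log p) * ((1 - (p : ℂ)⁻¹) / Real.log p *
              ((2 * (2 * π * I * n / Real.log p) + 1) ^ ℓ /
                (2 * (2 * π * I * n / Real.log p) - 3) ^ (ℓ + 2)))) + b) := by
  have hp1 : 1 < p := hp.one_lt
  have hp1R : (1 : ℝ) < p := by exact_mod_cast hp1
  set F : ℂ → ℂ := fun z => rhoArch z * rhoPrime p z * ((2 * z + 1) ^ ℓ / (2 * z - 3) ^ (ℓ + 2)) with hF
  set res : ℕ → ℂ := fun n =>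
      ((((-1 : ℝ) ^ n * 2 * (Real.sqrt π * π ^ (2 * n)) / (n ! * Real.Gamma (n + 1 / 2)) : ℝ)) : ℂ) *
        (rhoPrime p (-(2 * (n : ℂ))) * ((2 * (-(2 * (n : ℂ))) + 1) ^ ℓ / (2 * (-(2 * (n : ℂ))) - 3) ^ (ℓ + 2)))
    with hres
  set ST : ℂ := ∑' n : ℤ, if n = 0 then (0 : ℂ) else
      rhoArch (2 * π * I * n / Real.log p) * ((1 - (p : ℂ)⁻¹) / Real.log p *
        ((2 * (2 * π * I * n / Real.log p) + 1) ^ ℓ / (2 * (2 * π * I * n / Real.log p) - 3) ^ (ℓ + 2)))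
    with hST
  set Ib : ℂ := ∫ y : ℝ, F ((((1 / 2 : ℝ)) : ℂ) + y * I) with hIb
  set Lj : ℕ → ℂ := fun j => ∫ y : ℝ, F ((((1 / 2 - 2 * j : ℝ)) : ℂ) + y * I) with hLj
  have hsumres : Summable fun k : ℕ => res (k + 1) := by
    have h := summable_archPrime_archResidues hp1 ℓ
    refine h.congr fun k => ?_
    rw [hres]
  -- the identity at level `j`
  have hconst : ∀ᶠ j : ℕ in atTop, Lj j + 2 * π * ∑ k ∈ Finset.range (j - 1), res (k + 1) =
      Ib - 2 * π * (ST + b) := by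
    filter_upwards [eventually_ge_atTop 1] with j hj
    have h := integral_archPrime_line_sub_eq hp ℓ hab hj
    have hIco : ∑ n ∈ Finset.Ico 1 j, res n = ∑ k ∈ Finset.range (j - 1), res (k + 1) := by
      rw [Finset.sum_Ico_eq_sum_range]
      refine Finset.sum_congr rfl fun k _ => ?_
      rw [add_comm]
    have h' : Ib - Lj j = 2 * π * ((∑ k ∈ Finset.range (j - 1), res (k + 1)) + ST + b) := by
      rw [← hIco, hIb, hLj, hres, hST]
      exact h
    linear_combination (-1 : ℂ) * h'
  -- the left side tends to `0`
  have h_left : Tendsto Lj atTop (𝓝 0) := by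
    set C : ℝ := (16 * π ^ 2 / 3) ^ 3 * ((1 + (p : ℝ)⁻¹) / ((p : ℝ) ^ (3 / 2 : ℝ) - 1)) with hC
    have hcp : 0 ≤ (1 + (p : ℝ)⁻¹) / ((p : ℝ) ^ (3 / 2 : ℝ) - 1) := by
      have : 1 < (p : ℝ) ^ (3 / 2 : ℝ) := Real.one_lt_rpow hp1R (by norm_num)
      exact div_nonneg (by positivity) (by linarith)
    have hC0 : 0 ≤ C := by positivity
    have hbase : (1 : ℝ) ≤ 16 * π ^ 2 / 3 := by nlinarith [Real.pi_gt_three]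
    have hbound : ∀ j : ℕ, 1 ≤ j → ‖Lj j‖ ≤ C * (π / (2 * (4 * j + 2))) := by
      intro j hj
      have hj1 : (1 : ℝ) ≤ j := by exact_mod_cast hj
      have hc : (0 : ℝ) < 4 * j + 2 := by positivity
      have hg : Integrable fun y : ℝ => C * ((4 * (j : ℝ) + 2) ^ 2 + 4 * y ^ 2)⁻¹ := by
        have hcont : Continuous fun y : ℝ => ((4 * (j : ℝ) + 2) ^ 2 + 4 * y ^ 2)⁻¹ :=
          Continuous.inv₀ (by fun_prop) fun y => by positivity
        refine (Integrable.mono' (integrable_inv_one_add_sq.const_mul (4⁻¹))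
          hcont.aestronglyMeasurable (Eventually.of_forall fun y => ?_)).const_mul C
        rw [Real.norm_eq_abs, abs_of_pos (by positivity)]
        have h2 : (2 : ℝ) ≤ 4 * (j : ℝ) + 2 := by linarith
        have : 4 * (1 + y ^ 2) ≤ (4 * (j : ℝ) + 2) ^ 2 + 4 * y ^ 2 := by nlinarith [h2]
        calc ((4 * (j : ℝ) + 2) ^ 2 + 4 * y ^ 2)⁻¹ ≤ (4 * (1 + y ^ 2))⁻¹ := inv_anti₀ (by positivity) this
          _ = 4⁻¹ * (1 + y ^ 2)⁻¹ := mul_inv _ _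
      rw [hLj]
      refine (norm_integral_le_of_norm_le hg (Eventually.of_forall fun y => ?_)).trans (le_of_eq ?_)
      · have hre : ((((1 / 2 - 2 * j : ℝ)) : ℂ) + y * I).re ≤ 1 / 2 := by simp
        have hsq : ‖2 * ((((1 / 2 - 2 * j : ℝ)) : ℂ) + y * I) - 3‖ ^ 2 = (4 * j + 2) ^ 2 + 4 * y ^ 2 := by
          rw [ap_normSq_two_mul_sub_three]
          simp
          ring
        have h1 : ‖rhoArch ((((1 / 2 - 2 * j : ℝ)) : ℂ) + y * I)‖ ≤ (16 * π ^ 2 / 3) ^ 3 :=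
          (norm_rhoArch_leftLine_le j y).trans (pow_le_pow_right₀ hbase (min_le_right j 3))
        have h2 : ‖rhoPrime p ((((1 / 2 - 2 * j : ℝ)) : ℂ) + y * I)‖ ≤
            (1 + (p : ℝ)⁻¹) / ((p : ℝ) ^ (3 / 2 : ℝ) - 1) :=
          norm_rhoPrime_le_of_re_le hp1 (by norm_num) (by simp; linarith)
        calc ‖F ((((1 / 2 - 2 * j : ℝ)) : ℂ) + y * I)‖
            ≤ ‖rhoArch ((((1 / 2 - 2 * j : ℝ)) : ℂ) + y * I)‖ *
                ‖rhoPrime p ((((1 / 2 - 2 * j : ℝ)) : ℂ) + y * I)‖ *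
                (‖2 * ((((1 / 2 - 2 * j : ℝ)) : ℂ) + y * I) - 3‖ ^ 2)⁻¹ := ap_norm_F_le ℓ hre
          _ ≤ C * ((4 * (j : ℝ) + 2) ^ 2 + 4 * y ^ 2)⁻¹ := by
              rw [hsq, hC]
              exact mul_le_mul_of_nonneg_right (mul_le_mul h1 h2 (norm_nonneg _) (by positivity))
                (by positivity)
      · rw [integral_const_mul]
        have h : (fun y : ℝ => ((4 * (j : ℝ) + 2) ^ 2 + 4 * y ^ 2)⁻¹) =
            fun y : ℝ => ((4 * (j : ℝ) + 2) ^ 2)⁻¹ * (fun u : ℝ => (1 + u ^ 2)⁻¹) (2 / (4 * j + 2) * y) := by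
          funext y
          simp only
          rw [← mul_inv]
          congr 1
          field_simp
          ring
        rw [h, integral_const_mul, Measure.integral_comp_mul_left (fun u : ℝ => (1 + u ^ 2)⁻¹),
          integral_univ_inv_one_add_sq, smul_eq_mul, inv_div, abs_of_pos (by positivity)]
        field_simp
    have hlim : Tendsto (fun j : ℕ => C * (π / (2 * (4 * (j : ℝ) + 2)))) atTop (𝓝 0) := by
      have h1 : Tendsto (fun j : ℕ => 2 * (4 * (j : ℝ) + 2)) atTop atTop := by
        have h8 : Tendsto (fun j : ℕ => 8 * (j : ℝ) + 4) atTop atTop :=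
          tendsto_atTop_add_const_right _ 4
            (tendsto_natCast_atTop_atTop.const_mul_atTop (by positivity : (0:ℝ) < 8))
        refine h8.congr fun j => ?_
        ring
      simpa using (tendsto_const_nhds.div_atTop h1).const_mul C
    refine squeeze_zero_norm' ?_ hlim
    filter_upwards [eventually_ge_atTop 1] with j hj
    exact hbound j hj
  -- the partial sums of the `ρ_∞`-residues converge
  have h_res : Tendsto (fun j : ℕ => ∑ k ∈ Finset.range (j - 1), res (k + 1)) atTop
      (𝓝 (∑' k : ℕ, res (k + 1))) :=
    (hsumres.hasSum.tendsto_sum_nat).comp (tendsto_sub_atTop_nat 1)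
  have hlim : Tendsto (fun j : ℕ => Lj j + 2 * π * ∑ k ∈ Finset.range (j - 1), res (k + 1)) atTop
      (𝓝 (0 + 2 * π * ∑' k : ℕ, res (k + 1))) := h_left.add (h_res.const_mul _)
  rw [zero_add] at hlim
  have hlim' : Tendsto (fun j : ℕ => Lj j + 2 * π * ∑ k ∈ Finset.range (j - 1), res (k + 1)) atTop
      (𝓝 (Ib - 2 * π * (ST + b))) := tendsto_const_nhds.congr' (EventuallyEq.symm hconst)
  have h_eq := tendsto_nhds_unique hlim' hlim
  have : Ib = 2 * π * ((∑' k : ℕ, res (k + 1)) + ST + b) := by linear_combination h_eq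
  rw [this, hres]

end LineLimit

/-! ### G. The negative Fourier coefficients of `κκ_p` on `S¹` -/

section FourierCoefficients

/-- RH-FREE. `(2p+1)^m(2p−3)^{−m−2}` at `p = −2n` is `x(n)^m/(4n+3)²`, `x(n) = ψ⁻¹(−2n)`. [folklore] -/
private theorem ap_ratFactor_pole (m n : ℕ) :
    (2 * (-(2 * (n : ℂ))) + 1) ^ m / (2 * (-(2 * (n : ℂ))) - 3) ^ (m + 2) =
      (((xArch n ^ m / (4 * n + 3) ^ 2 : ℝ)) : ℂ) := by
  have h3 : (2 * (-(2 * (n : ℂ))) - 3) ≠ 0 := by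
    intro h
    have := congrArg Complex.re h
    simp at this
    linarith [n.cast_nonneg (α := ℝ)]
  push_cast
  rw [xArch_eq_cayleyInv, cayleyInv, pow_add, ← div_div, ← div_pow]
  congr 1
  ring

/-- RH-FREE. The residue term at `−2n` is `−α(n)x(n)^m/8`. [cite: ConnesConsani2021QuasiInner, §2 (arXiv chunk p0005:L104–L115)] -/
private theorem ap_res_mul_ratFactor (m n : ℕ) :
    ((((-1 : ℝ) ^ n * 2 * (Real.sqrt π * π ^ (2 * n)) / (n ! * Real.Gamma (n + 1 / 2)) : ℝ)) : ℂ) *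
        ((2 * (-(2 * (n : ℂ))) + 1) ^ m / (2 * (-(2 * (n : ℂ))) - 3) ^ (m + 2)) =
      (((-(alphaArch n * xArch n ^ m) / 8 : ℝ)) : ℂ) := by
  rw [ap_ratFactor_pole, ← ofReal_mul]
  congr 1
  have hG : Real.Gamma ((n : ℝ) + 1 / 2) ≠ 0 := by linarith [ap_half_le_Gamma_nat_add_half n]
  have hfac : (n ! : ℝ) ≠ 0 := by exact_mod_cast n.factorial_ne_zero
  have h43 : (4 * (n : ℝ) + 3) ≠ 0 := by positivity
  unfold alphaArch
  rw [Real.Gamma_nat_eq_factorial]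
  field_simp
  ring

/-- RH-FREE. **The negative Fourier coefficients of `κ_{p,∞} = (ρ_∞ρ_p) ∘ ψ` on `S¹`** (Theorem 4.4 (ii),
scalar content of `(1 − 𝒫)κκ_p𝒫 = ℰ_∞ + ℰ_p + ℰ_0`): there are constants `A`, `B` (depending only on `p`)
such that for every `ℓ ≥ 0`
`(κκ_p)^(−ℓ−1) = Σ_{n≥1} α(n)ρ_p(−2n)x(n)^ℓ + Σ_{n≠0} ρ_∞(2πin/log p)·8(1−p⁻¹)log p(4πn+3i log p)⁻² x_p(n)^ℓ
 + (A + Bℓ)(−⅓)^ℓ`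
— the `ρ_∞`-poles with «the residue multiplied by `ρ_p(−2n)`» (display (4.3)), the `ρ_p`-poles with the
residue (offdiag2) «multiplied by `ρ_∞(2πin/log p)`» (display (4.4), the entries of `D`), and the double pole
at `0` whose «dependence in `k` is of the form `αx^{k−1} + (k−1)βx^{k−1}`, `x = −⅓`» (the finite-rank `ℰ_0`).
[cite: ConnesConsani2021QuasiInner, Thm 4.4 (ii) proof (arXiv chunks p0011:L102–p0012:L35)] -/
theorem exists_fourierCoeff_kappaArchPrime_eq {p : ℕ} (hp : p.Prime) :
    ∃ A B : ℂ, ∀ ℓ : ℕ,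
      fourierCoeff (T := 1) (circleRestrict 1 fun v => kappaArch v * kappaPrime p v) (-((ℓ + 1 : ℕ) : ℤ)) =
        (∑' k : ℕ, (alphaArch (k + 1) : ℂ) * rhoPrime p (-(2 * ((k + 1 : ℕ) : ℂ))) *
            (xArch (k + 1) : ℂ) ^ ℓ) +
          (∑' n : ℤ, if n = 0 then (0 : ℂ) else
            rhoArch (2 * π * I * n / Real.log p) *
              (8 * (1 - (p : ℂ)⁻¹) * Real.log p / (4 * π * n + 3 * I * Real.log p) ^ 2 * xPrime p n ^ ℓ)) +
          (A + B * ℓ) * (-1 / 3 : ℂ) ^ ℓ := by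
  have hp1 : 1 < p := hp.one_lt
  have hπ : (π : ℂ) ≠ 0 := ofReal_ne_zero.mpr Real.pi_pos.ne'
  obtain ⟨A₀, B₀, hAB⟩ := exists_archPrime_doublePole_sub hp1
  refine ⟨-8 * A₀, -8 * B₀, fun ℓ => ?_⟩
  obtain ⟨a, ψ, W, hW, hψd, hψ0, hψeq⟩ := hAB ℓ
  have hline := integral_archPrime_criticalLine_eq_tsum hp ℓ (a := a) (b := (A₀ + B₀ * ℓ) * (-1 / 3 : ℂ) ^ ℓ)
    ⟨ψ, W, hW, hψd, hψ0, hψeq⟩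
  -- the change of variables `S¹ → ∂ℂ₋`
  have hcov := fourierCoeff_circleRestrict_neg_eq_integral (fun v => kappaArch v * kappaPrime p v) (ℓ + 1)
  have hpt : ∀ t : ℝ, (((π⁻¹ * (1 + t ^ 2)⁻¹ : ℝ)) : ℂ) *
      (cayleyInv (1 / 2 + t * I) ^ (ℓ + 1) *
        (fun v => kappaArch v * kappaPrime p v) (cayleyInv (1 / 2 + t * I))) =
      -(4 / π : ℂ) * (rhoArch ((((1 / 2 : ℝ)) : ℂ) + t * I) * rhoPrime p ((((1 / 2 : ℝ)) : ℂ) + t * I) *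
        ((2 * ((((1 / 2 : ℝ)) : ℂ) + t * I) + 1) ^ ℓ / (2 * ((((1 / 2 : ℝ)) : ℂ) + t * I) - 3) ^ (ℓ + 2))) := by
    intro t
    set z : ℂ := 1 / 2 + (t : ℂ) * I with hzD
    have hz : z ≠ 3 / 2 := by
      intro h
      have := congrArg Complex.re h
      rw [hzD] at this
      simp at this
      norm_num at this
    have h12 : ((((1 / 2 : ℝ)) : ℂ)) + (t : ℂ) * I = z := by rw [hzD]; push_cast; ring
    simp only
    rw [h12, kappaArch, kappaPrime, cayley_cayleyInv hz, cayleyInv]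
    set A : ℂ := 2 * z + 1 with hA
    set B : ℂ := 2 * z - 3 with hB
    have hA0 : A ≠ 0 := by
      intro h
      have := congrArg Complex.re h
      rw [hA, hzD] at this
      norm_num at this
    have hB0 : B ≠ 0 := by
      intro h
      have := congrArg Complex.re h
      rw [hB, hzD] at this
      norm_num at this
    have hq : (((1 + t ^ 2 : ℝ)) : ℂ) = -(A * B) / 4 := by
      rw [hA, hB, hzD]
      push_cast
      linear_combination ((t : ℂ) ^ 2) * I_sq
    have hcast : (((π⁻¹ * (1 + t ^ 2)⁻¹ : ℝ)) : ℂ) = (π : ℂ)⁻¹ * ((((1 + t ^ 2 : ℝ)) : ℂ))⁻¹ := by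
      push_cast; ring
    rw [hcast, hq, div_pow]
    field_simp
    ring
  rw [hcov]
  simp_rw [hpt]
  rw [integral_const_mul, hline]
  -- the three groups of terms
  have hA : -(4 / π : ℂ) * (2 * π) = -8 := by field_simp; ring
  have e1 : ∀ k : ℕ,
      -8 * (((((-1 : ℝ) ^ (k + 1) * 2 * (Real.sqrt π * π ^ (2 * (k + 1))) /
          ((k + 1) ! * Real.Gamma ((k + 1 : ℕ) + 1 / 2)) : ℝ)) : ℂ) *
        (rhoPrime p (-(2 * ((k + 1 : ℕ) : ℂ))) *
          ((2 * (-(2 * ((k + 1 : ℕ) : ℂ))) + 1) ^ ℓ / (2 * (-(2 * ((k + 1 : ℕ) : ℂ))) - 3) ^ (ℓ + 2)))) =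
      (alphaArch (k + 1) : ℂ) * rhoPrime p (-(2 * ((k + 1 : ℕ) : ℂ))) * (xArch (k + 1) : ℂ) ^ ℓ := by
    intro k
    have h := ap_res_mul_ratFactor ℓ (k + 1)
    set C : ℂ := ((((-1 : ℝ) ^ (k + 1) * 2 * (Real.sqrt π * π ^ (2 * (k + 1))) /
          ((k + 1) ! * Real.Gamma ((k + 1 : ℕ) + 1 / 2)) : ℝ)) : ℂ) with hC
    set Kf : ℂ := (2 * (-(2 * ((k + 1 : ℕ) : ℂ))) + 1) ^ ℓ / (2 * (-(2 * ((k + 1 : ℕ) : ℂ))) - 3) ^ (ℓ + 2)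
      with hKf
    set ρ : ℂ := rhoPrime p (-(2 * ((k + 1 : ℕ) : ℂ))) with hρ
    rw [show -8 * (C * (ρ * Kf)) = -8 * (C * Kf) * ρ by ring, h]
    push_cast
    ring
  have e2 : ∀ n : ℤ, -8 * (if n = 0 then (0 : ℂ) else
      rhoArch (2 * π * I * n / Real.log p) * ((1 - (p : ℂ)⁻¹) / Real.log p *
        ((2 * (2 * π * I * n / Real.log p) + 1) ^ ℓ / (2 * (2 * π * I * n / Real.log p) - 3) ^ (ℓ + 2)))) =
      (if n = 0 then (0 : ℂ) else rhoArch (2 * π * I * n / Real.log p) *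
        (8 * (1 - (p : ℂ)⁻¹) * Real.log p / (4 * π * n + 3 * I * Real.log p) ^ 2 * xPrime p n ^ ℓ)) := by
    intro n
    split_ifs with hn
    · simp
    · rw [← residueCoeff_eq hp1 n ℓ, ap_kernel_eq]
      ring
  set S1 : ℂ := ∑' k : ℕ,
      ((((-1 : ℝ) ^ (k + 1) * 2 * (Real.sqrt π * π ^ (2 * (k + 1))) /
          ((k + 1) ! * Real.Gamma ((k + 1 : ℕ) + 1 / 2)) : ℝ)) : ℂ) *
        (rhoPrime p (-(2 * ((k + 1 : ℕ) : ℂ))) *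
          ((2 * (-(2 * ((k + 1 : ℕ) : ℂ))) + 1) ^ ℓ / (2 * (-(2 * ((k + 1 : ℕ) : ℂ))) - 3) ^ (ℓ + 2)))
    with hS1
  set S2 : ℂ := ∑' n : ℤ, if n = 0 then (0 : ℂ) else
      rhoArch (2 * π * I * n / Real.log p) * ((1 - (p : ℂ)⁻¹) / Real.log p *
        ((2 * (2 * π * I * n / Real.log p) + 1) ^ ℓ / (2 * (2 * π * I * n / Real.log p) - 3) ^ (ℓ + 2)))
    with hS2
  rw [show -(4 / π : ℂ) * (2 * π * (S1 + S2 + (A₀ + B₀ * ℓ) * (-1 / 3 : ℂ) ^ ℓ)) =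
      -8 * S1 + -8 * S2 + (-8 * A₀ + -8 * B₀ * ℓ) * (-1 / 3 : ℂ) ^ ℓ by rw [← mul_assoc, hA]; ring,
    hS1, hS2, ← tsum_mul_left, ← tsum_mul_left, tsum_congr e1, tsum_congr e2]

end FourierCoefficients

end QuasiInner

end Literature.NumberTheory.ConnesConsani2021
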